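import Literature.Analysis.OperatorTheory.Enflo2023.StepRealisationScale
import Literature.Analysis.OperatorTheory.Enflo2023.Lemma1Standing
import HarnessLib

/-!
# Enflo (2023), v2 p.19 l.655–677 with (34) p.16: the run-level independence hypothesis `IndepRunκ` in a TYPE-1
model — `T_τ = τ·diag(1, ½)` on `ℂ²`, coefficients in `ℓ²(ℕ)` with the shift `S`, the paper's own `V_y` — a
kernel-checked calibration (it FAILS there, from every admissible start, although the type-1 inequalities (19) hold
in the strongest form and every vector of the run is cyclic)

P. H. Enflo, *On the invariant subspace problem in Hilbert spaces*, arXiv:2305.15442v2 (2023) — a CLAIMED result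
under adjudication; nothing in this file asserts the manuscript's theorem, and nothing here refutes it either: the
model operator acts on `ℂ²`, so it HAS invariant subspaces (`Diag.hasNontrivialClosedInvariantSubspace`) and is not an
instance of the packaged residual `PartBResidualIndepκ` (infinite-dimensional `H`); see the STATUS paragraph.

WHAT IS CALIBRATED.  `StepRealisationScale` isolates the residual of Part B as the run-level hypothesis
`IndepRunκ T x₀ S ι σ β s₀` ((34) with each functional at its own scale, one modulus `σ`, asked at every state
reachable from `s₀` by the Main Construction with ratio `β`; v2 p.19 l.667–677: "we can assume that for all `n`,
`y_n` will be `δ₂`-linearly independent") and proves `PartBResidualIndepκ → ISP_separable`.  The text DERIVES that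
independence (p.19 l.655–662) from "`T` is of type 1": `|⟨T^{j₂}y_n, y_n⟩| ≥ δ₂‖y_n‖²` for some `j₂ > n₀` (p.6 (19)).
`StepRealisationToy` showed `IndepRunκ` false in the minimal model `T = τJ` on `ℂ²` — but `(τJ)² = 0` is of type 2,
so that model "cannot test `Type1 → IndepRunκ` at all" (referee record §41.3 (iii)).  THIS FILE IS THAT TEST, in the
smallest type-1 model, built from the tree's own objects (`Vy.ℓ2`, `Vy.S`, `Vy.V`, `MCStep.State`, `Wn`, `IndepAtκ`,
`IndepRunκ`, `exists_state_stepκ`, `Comm S`/`ιS S` — no new hypothesis objects):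
* `H = ℂ²` (`EuclideanSpace ℂ (Fin 2)`), `T_τ = τ·diag(1, ½)` (`Diag.TD`), `0 < τ` (the text's `‖T‖ = 10⁻²⁰` is
  `τ = 10⁻²⁰`); `E = ℓ²(ℕ)`, `S` = the right shift (the text's coefficient model, (2)–(4), (9)), step directions =
  the full commutant `{S}'` through `ιS S` (it contains every `r(S)`, `r` a polynomial: the text's `y → y + r(T)y`).
* `Diag.type1`: `T_τ` IS OF TYPE 1 (p.6) in the strongest form — `u₀ = e₀`, `δ_n = (τ/2)ⁿ`, `j = n`, and
  `|⟨T_τʲy, y⟩| = τʲ|y₀|² + (τ/2)ʲ|y₁|² ≥ δ_j‖y‖²` for EVERY `y` (no angular condition needed); `Diag.not_type2`;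
  `Diag.TD_injective`; `Diag.cyclic_of_ne`: every `y` with `y₀y₁ ≠ 0` is cyclic, in particular `x₀ = (4/5, 3/5)`
  (`Diag.cyclic_xD`) and the start vector (`Diag.cyclic_yD`).
* `Diag.indepRunκ_etheta_eq_zero`: for EVERY admissible start (`‖x₀‖ = 1`, `0 < σ ≤ 1`, `0 < β ≤ σ²/1000`, the start
  margin of `claimRun_of_indepRunκ`) and every `τ ≤ σ/100` (the text's regime: `‖T‖` is smaller than every other
  constant, v2 p.1, p.7): `IndepRunκ T_τ x₀ S (ιS S) σ β s₀ → (εθ)₀ = 0`.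
* `Diag.exists_start_at` / `Diag.not_indepRunκ`: admissible starts with `0 < (εθ)₀ ≤ τ²` exist for `τ ≤ σ/100` —
  concretely `x₀ = (4/5, 3/5)` (`Diag.xD`), `W = V_y` for `y = (Y₀, τ)` (`Diag.WD`, `Diag.yD`; LITERALLY `Vy.V T_τ _ y`),
  bracket point `z = (0, ζ)` (`Diag.zD`, `Diag.isBracket_start`), `(εθ)₀ = ζ²θ`, `θ = τ²/(1 − τ²/4)`; hence the
  predicate is FALSE in the model for all `0 < τ ≤ σ/100`, `0 < σ ≤ 1`, `0 < β ≤ σ²/1000`.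
MECHANISM (new, and different from the toy's tilt drift: here THE DYNAMICS CANNOT KILL AN EIGEN-COMPONENT, WHILE (16)
SAYS ONE MUST DIE).  (a) STRUCTURE (`Diag.adjoint_u`): `V ∘ S = T_τ ∘ V` forces `V†u_i = c_i·g_{t_i}` with the
geometric vectors `g_μ = (1, μ, μ², …) ∈ ℓ²` (eigenvectors of `S†`, `Diag.inner_gv_S`), `t₀ = τ`, `t₁ = τ/2`; so
`K = VV†` has matrix `conj(c_i)c_kG_{ik}`, `G_{ik} = ⟪g_{t_i}, g_{t_k}⟫ = 1/(1 − t_it_k)` (`Diag.K_apply`), with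
`tr K = m₀G₀₀ + m₁G₁₁`, `det K = m₀m₁Δ`, `m_i = |c_i|²`, `Δ = G₀₀G₁₁ − G₀₁² > 0` (`Diag.Δ_pos`).  (b) CAYLEY–HAMILTON AT
A BRACKET POINT (`Diag.ch_bracket`): `z + Kz = x₀` gives `tr K·⟨z,Kz⟩ = ‖Kz‖² + det K·‖z‖²`, i.e.
`(m₀G₀₀ + m₁G₁₁)(εθ) = ‖x₀ − z‖² + Δm₀m₁‖z‖²`; at a true MC state (`‖z‖, ‖x₀ − z‖ ≥ 0.3`) this is the STATE BOUND
`0.0081·Δ·cyc ≤ (εθ)²`, `cyc := m₀m₁/(m₀ + m₁)²` scale-free (`Diag.state_bound`, `Diag.cyc_le`).  (c) THE COMMUTANT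
ACTS DIAGONALLY (`Diag.adjoint_gv_of_comm`): `NS = SN ⟹ N†g_μ = n_μg_μ`, `|n_μ| ≤ ‖N‖`, and
`|n_τ − n_{τ/2}| ≤ 2‖N‖·‖g_τ − g_{τ/2}‖ ≤ 2‖N‖τ` (`Diag.norm_ev_sub_le`, `Diag.norm_gv_sub_le`); an admissible step
`W ↦ r·W(1+N)`, `‖N‖ ≤ 2β/σ`, maps `c_i ↦ r̄c_i(1 + n_{t_i})` (`Diag.cf_comp`), so `cyc` drops per step at most by the
factor `(1 + 8βτ/σ)²` (`Diag.cyc_step`).  (d) Along the run `(εθ)_n = (1−β)ⁿ(εθ)₀` exactly while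
`cyc_n ≥ (1 + 8βτ/σ)^{−2n}cyc₀`, so (b) gives `0.0081·Δ·cyc₀ ≤ ((1−β)(1 + 8βτ/σ))^{2n}(εθ)₀² → 0` because
`8τ/σ ≤ 0.08 < 1` — absurd when `cyc₀ > 0`; and `cyc₀ = 0` (an eigen-component of `y` vanishes, `range W† ⊆ ℂg`)
makes `ℓ ∥ κ(x₀ − z)`, which `indepBrκ_self_le` excludes at the first pivot (`Diag.not_indepBrκ_of_degenerate`).
In words: (16) forces the MC vectors' coefficient operators to concentrate on ONE eigen-direction of `T†` at the
geometric rate `(1−β)^{n/2}`, but an admissible step can only re-weight the two eigen-components by factors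
`1 + n_{t_i}` that differ by `≤ 4βτ/σ` — the polynomial `r` cannot separate the two nearby eigenvalues `τ, τ/2` fast
enough.  Every `y_n = V_ne₀` of the run keeps both components (`Diag.cyc_step`), i.e. stays CYCLIC.
SCOPE OF THE HYPOTHESIS `τ ≤ σ/100`.  It is used twice: for the closure `(1−β)(1+8βτ/σ) < 1` (`τ < σ/8` would do) and
for the start margin.  For `σ < 8τ` (a modulus below the operator norm — outside the text's standing regime) the
counting above is inconclusive and nothing is claimed.
STATUS / what this says about the text.  The model meets every hypothesis that pp.16–20 invoke in an inference this
record can identify — `T` of type 1 via `u₀` with `δ_n` independent of `y` (p.19 l.655–662), `(εθ)_n > 0` and `y_n`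
cyclic along the run (p.3, p.17), true MC states with `0.3 ≤ ε ≤ 0.7` (p.17), steps `y → y + r(T)y` of relative size
`O(β/σ)` ((35)–(38)), `(εθ)` decreasing by the factor `1 − β` ((45)–(46)) — and misses exactly two: `dim H = ∞` and
"`T` has no non-trivial closed invariant subspace".  So the passage from type 1 (l.655–662) to "`y_n` `δ₂`-linearly
independent for all `n`" (l.667–677) does not follow from the type-1 inequalities and the construction alone; if it
holds in the text's setting it must use infinite-dimensionality / the absence of invariant subspaces in a way the
text does not state — consistent with, and sharpening, the located inference of the record ((34) p.16 for `f f̄`,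
`f ḡ` with one modulus along the run; referee §39.5, §41.3).  It does NOT refute the type-1-conditioned residual
R-V19f (`Type1 T → ¬NIS T → …` on infinite-dimensional `H`), of which no finite-dimensional operator is an instance,
and it decides nothing about operators without invariant subspaces (for those the state bound's modulus `Δ·cyc` has
no uniform floor; deciding `IndepRunκ` for all such `T` is ISP-hard, as recorded in `StepRealisationToy`).
No new axioms; zero `sorry`; imports `StepRealisationScale` (the predicate) and `Lemma1Standing` (the unit vectors
`e_k` of `ℓ²` and their four elementary lemmas, reused, not restated).
-/

noncomputable section

open scoped InnerProductSpace ComplexConjugate ENNReal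
open ContinuousLinearMap Filter Topology

namespace Literature.Analysis.OperatorTheory.Enflo2023

namespace StepRealisation

open MCStep Vy
open Lemma1.Standing (e e_apply norm_e inner_e_left)

namespace Diag

/-- `ℂ²` as a Hilbert space (the model's `H`). [folklore] -/
abbrev C2 : Type := EuclideanSpace ℂ (Fin 2)

/-! ### A. `ℓ²` preliminaries: the shift on unit vectors, geometric vectors `g_μ = (μʲ)_j`, their Gram values -/

/-- `S e_j = e_{j+1}`. [folklore] -/
lemma S_e (j : ℕ) : S (e j) = e (j + 1) := by
  apply lp.ext
  funext k
  cases k with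
  | zero => rw [S_apply_zero, e_apply]; simp
  | succ k => rw [S_apply_succ, e_apply, e_apply]; simp

/-- `⟪a, e_j⟫ = conj a_j`. [folklore] -/
lemma inner_e_right (j : ℕ) (a : ℓ2) : ⟪a, e j⟫_ℂ = conj (a j) := by
  rw [← inner_conj_symm, inner_e_left]

/-- a geometric sequence with ratio `|μ| < 1` is square-summable. [folklore] -/
lemma memℓp_geom {μ : ℝ} (h : |μ| < 1) : Memℓp (fun j : ℕ => ((μ : ℂ)) ^ j) 2 := by
  rw [memℓp_gen_iff (by norm_num : 0 < (2 : ℝ≥0∞).toReal)]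
  simp only [ENNReal.toReal_ofNat, Real.rpow_two, norm_pow, Complex.norm_real, Real.norm_eq_abs]
  have : Summable (fun j : ℕ => (|μ| ^ 2) ^ j) :=
    summable_geometric_of_lt_one (by positivity) (by nlinarith [abs_nonneg μ])
  refine (this.congr fun j => ?_)
  rw [← pow_mul, ← pow_mul, mul_comm]

/-- THE GEOMETRIC VECTOR `g_μ = (1, μ, μ², …) ∈ ℓ²` (`|μ| < 1`; `0` otherwise): the eigenvector of the left shift `S†`
with eigenvalue `μ`, i.e. `V_y†` of an eigenvector of `T†`. [folklore] -/
def gv (μ : ℝ) : ℓ2 := if h : |μ| < 1 then ⟨fun j => ((μ : ℂ)) ^ j, memℓp_geom h⟩ else 0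

/-- coordinates of `g_μ`. [folklore] -/
lemma gv_apply {μ : ℝ} (h : |μ| < 1) (j : ℕ) : gv μ j = (μ : ℂ) ^ j := by
  rw [gv, dif_pos h]

/-- `(g_μ)₀ = 1`. [folklore] -/
lemma gv_zero {μ : ℝ} (h : |μ| < 1) : gv μ 0 = 1 := by rw [gv_apply h, pow_zero]

/-- THE GRAM VALUES `⟪g_μ, g_ν⟫ = 1/(1 − μν)`. [folklore] -/
lemma inner_gv_gv {μ ν : ℝ} (hμ : |μ| < 1) (hν : |ν| < 1) :
    ⟪gv μ, gv ν⟫_ℂ = (((1 - μ * ν)⁻¹ : ℝ) : ℂ) := by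
  rw [lp.inner_eq_tsum]
  have hξ : ‖((μ * ν : ℝ) : ℂ)‖ < 1 := by
    rw [Complex.norm_real, Real.norm_eq_abs, abs_mul]
    nlinarith [abs_nonneg μ, abs_nonneg ν]
  have h := tsum_geometric_of_norm_lt_one hξ
  have e : (fun j => ⟪gv μ j, gv ν j⟫_ℂ) = fun j => ((μ * ν : ℝ) : ℂ) ^ j := by
    funext j
    rw [gv_apply hμ, gv_apply hν]
    simp [mul_pow, mul_comm]
  rw [e, h]
  push_cast
  rfl

/-- `‖g_μ‖² = 1/(1 − μ²)`. [folklore] -/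
lemma norm_gv_sq {μ : ℝ} (hμ : |μ| < 1) : ‖gv μ‖ ^ 2 = (1 - μ * μ)⁻¹ := by
  have h := inner_gv_gv hμ hμ
  rw [inner_self_eq_norm_sq_to_K] at h
  exact_mod_cast (Complex.ofReal_injective (by simpa using h) : ‖gv μ‖ ^ 2 = (1 - μ * μ)⁻¹)

/-- `1 ≤ ‖g_μ‖`. [folklore] -/
lemma one_le_norm_gv {μ : ℝ} (hμ : |μ| < 1) : 1 ≤ ‖gv μ‖ := by
  have h := norm_gv_sq hμ
  have h1 : (1 : ℝ) ≤ (1 - μ * μ)⁻¹ := by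
    rw [le_inv_comm₀ (by norm_num) (by nlinarith [abs_nonneg μ, abs_lt.1 hμ]), inv_one]
    nlinarith
  nlinarith [norm_nonneg (gv μ)]

/-- one coordinate of `⟪g_μ, S b⟫`. [folklore] -/
lemma inner_gv_S_succ {μ : ℝ} (hμ : |μ| < 1) (b : ℓ2) (j : ℕ) :
    ⟪gv μ (j + 1), S b (j + 1)⟫_ℂ = (μ : ℂ) * ⟪gv μ j, b j⟫_ℂ := by
  rw [S_apply_succ, gv_apply hμ, gv_apply hμ, pow_succ]
  simp only [RCLike.inner_apply', map_mul, map_pow, Complex.conj_ofReal]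
  ring

/-- `g_μ` IS AN EIGENVECTOR OF `S†`: `⟪g_μ, S b⟫ = μ⟪g_μ, b⟫`. [folklore] -/
lemma inner_gv_S {μ : ℝ} (hμ : |μ| < 1) (b : ℓ2) : ⟪gv μ, S b⟫_ℂ = (μ : ℂ) * ⟪gv μ, b⟫_ℂ := by
  have hs : Summable fun j => ⟪gv μ j, S b j⟫_ℂ := lp.summable_inner (gv μ) (S b)
  rw [lp.inner_eq_tsum, lp.inner_eq_tsum, hs.tsum_eq_zero_add]
  have h0' : ⟪gv μ 0, S b 0⟫_ℂ = 0 := by rw [S_apply_zero, inner_zero_right]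
  rw [h0', zero_add, ← tsum_mul_left]
  exact tsum_congr fun j => inner_gv_S_succ hμ b j

/-- `⟪g_μ, e_j⟫ = μʲ`. [folklore] -/
lemma inner_gv_e {μ : ℝ} (hμ : |μ| < 1) (j : ℕ) : ⟪gv μ, e j⟫_ℂ = (μ : ℂ) ^ j := by
  rw [inner_e_right, gv_apply hμ, map_pow, Complex.conj_ofReal]

/-! ### B. The model: `H = ℂ²`, `T_τ = τ·diag(1, ½)`; the paper's `V_y : ℓ² → ℂ²`, `S` = the right shift -/

/-- the two eigenvalues `τ, τ/2` of `T_τ`. [folklore] -/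
def wt (τ : ℝ) : Fin 2 → ℝ := ![τ, τ / 2]

/-- `wt₀ = τ`. [folklore] -/
@[simp] lemma wt_zero (τ : ℝ) : wt τ 0 = τ := rfl

/-- `wt₁ = τ/2`. [folklore] -/
@[simp] lemma wt_one (τ : ℝ) : wt τ 1 = τ / 2 := rfl

/-- `|wt i| < 1` for `0 < τ < 1`. [folklore] -/
lemma abs_wt_lt {τ : ℝ} (hτ : 0 < τ) (hτ1 : τ < 1) (i : Fin 2) : |wt τ i| < 1 := by
  fin_cases i
  · show |τ| < 1
    rw [abs_of_pos hτ]; exact hτ1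
  · show |τ / 2| < 1
    rw [abs_of_pos (by positivity)]; linarith

/-- the unit vectors of `ℂ²`. [folklore] -/
def u (i : Fin 2) : C2 := EuclideanSpace.single i (1 : ℂ)

/-- `(u_i)_i = 1`. [folklore] -/
@[simp] lemma u_apply_self (i : Fin 2) : u i i = 1 := by simp [u]

/-- `(u₀)₁ = 0`. [folklore] -/
@[simp] lemma u_zero_one : u 0 1 = 0 := by simp [u]

/-- `(u₁)₀ = 0`. [folklore] -/
@[simp] lemma u_one_zero : u 1 0 = 0 := by simp [u]

/-- `⟪u_i, v⟫ = v_i`. [folklore] -/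
@[simp] lemma inner_u_left (i : Fin 2) (v : C2) : ⟪u i, v⟫_ℂ = v i := by
  simp [u, EuclideanSpace.inner_single_left]

/-- `⟪v, u_i⟫ = conj v_i`. [folklore] -/
@[simp] lemma inner_u_right (i : Fin 2) (v : C2) : ⟪v, u i⟫_ℂ = conj (v i) := by
  simp [u, EuclideanSpace.inner_single_right]

/-- coordinates in `ℂ²`. [folklore] -/
lemma decomp_u (v : C2) : v = v 0 • u 0 + v 1 • u 1 := by
  ext i
  fin_cases i <;> simp [u]

/-- `‖v‖² = |v₀|² + |v₁|²` on `ℂ²`. [folklore] -/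
lemma norm_sq_C2 (w : C2) : ‖w 0‖ ^ 2 + ‖w 1‖ ^ 2 = ‖w‖ ^ 2 := by
  rw [EuclideanSpace.norm_sq_eq, Fin.sum_univ_two]

/-- THE MODEL OPERATOR `T_τ = τ·diag(1, ½)` on `ℂ²`: injective, not nilpotent, two distinct eigenvalues; of the paper's
TYPE 1 (`type1`), with cyclic vectors (`dense_orbit`), and — being finite-dimensional — with invariant subspaces.
[cite: Enflo2023, v2 p.6 (19), p.7] -/
def TD (τ : ℝ) : C2 →L[ℂ] C2 :=
  ((τ : ℝ) : ℂ) • (EuclideanSpace.proj (0 : Fin 2) : C2 →L[ℂ] ℂ).smulRight (u 0) +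
    ((τ / 2 : ℝ) : ℂ) • (EuclideanSpace.proj (1 : Fin 2) : C2 →L[ℂ] ℂ).smulRight (u 1)

/-- `(T_τ v)_i = wt_i · v_i`. [folklore] -/
@[simp] lemma TD_apply (τ : ℝ) (v : C2) (i : Fin 2) : (TD τ v) i = ((wt τ i : ℝ) : ℂ) * v i := by
  fin_cases i <;> simp [TD, u, mul_comm]

/-- `‖T_τ v‖ ≤ τ‖v‖`. [folklore] -/
lemma norm_TD_apply_le {τ : ℝ} (hτ : 0 ≤ τ) (v : C2) : ‖TD τ v‖ ≤ τ * ‖v‖ := by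
  have h1 : ‖TD τ v‖ ^ 2 ≤ (τ * ‖v‖) ^ 2 := by
    rw [← norm_sq_C2, mul_pow, ← norm_sq_C2, TD_apply, TD_apply, norm_mul, norm_mul, wt_zero, wt_one,
      Complex.norm_real, Complex.norm_real, Real.norm_of_nonneg hτ, Real.norm_of_nonneg (by positivity)]
    nlinarith [norm_nonneg (v 0), norm_nonneg (v 1), sq_nonneg (‖v 1‖), mul_nonneg hτ hτ]
  exact pow_le_pow_iff_left₀ (norm_nonneg _) (by positivity) two_ne_zero |>.1 h1


/-! ### C. Intertwiners `V ∘ S = T_τ ∘ V` (the model's (31)): `V† u_i = c_i · g_{wt i}`, the matrix of `K = VV†` -/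

section intertwiner

variable {τ : ℝ} {V : ℓ2 →L[ℂ] C2}

/-- THE TWO COEFFICIENTS `c_i := (V† u_i)₀` of an intertwiner `V` (for `V = V_y`: `c_i = conj yᵢ`). [folklore] -/
def cf (V : ℓ2 →L[ℂ] C2) (i : Fin 2) : ℂ := adjoint V (u i) 0

/-- coordinates of `V†w`: `(V†w)_k = ⟪V e_k, w⟫`. [folklore] -/
lemma adjoint_apply_coord (V : ℓ2 →L[ℂ] C2) (w : C2) (k : ℕ) : adjoint V w k = ⟪V (e k), w⟫_ℂ := by
  rw [← inner_e_left, adjoint_inner_right]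

/-- the recursion `(V†u_i)_{k+1} = wt_i (V†u_i)_k` forced by `V S = T_τ V`. [cite: Enflo2023, v2 (2)–(4) p.2] -/
lemma adjoint_u_succ (hVS : ∀ b, V (S b) = TD τ (V b)) (i : Fin 2) (k : ℕ) :
    adjoint V (u i) (k + 1) = ((wt τ i : ℝ) : ℂ) * adjoint V (u i) k := by
  rw [adjoint_apply_coord, adjoint_apply_coord, ← S_e, hVS, inner_u_right, inner_u_right, TD_apply,
    map_mul, Complex.conj_ofReal]

/-- STRUCTURE OF THE INTERTWINERS of `S` with `T_τ`: `V† u_i = c_i · g_{wt i}` — the range of `V†` lies in the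
plane `span(g_τ, g_{τ/2})` of `S†`-eigenvectors. [cite: Enflo2023, v2 (2)–(4) p.2 (`V_y`, `V_y†`)] -/
lemma adjoint_u (hτ : 0 < τ) (hτ1 : τ < 1) (hVS : ∀ b, V (S b) = TD τ (V b)) (i : Fin 2) :
    adjoint V (u i) = cf V i • gv (wt τ i) := by
  apply lp.ext
  funext k
  rw [lp.coeFn_smul, Pi.smul_apply, smul_eq_mul, gv_apply (abs_wt_lt hτ hτ1 i)]
  induction k with
  | zero => rw [pow_zero, mul_one]; rfl
  | succ k ih => rw [adjoint_u_succ hVS, ih, pow_succ]; ring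

/-- `V†w = (w₀c₀)·g_τ + (w₁c₁)·g_{τ/2}`. [cite: Enflo2023, v2 (4) p.2] -/
lemma adjoint_eq (hτ : 0 < τ) (hτ1 : τ < 1) (hVS : ∀ b, V (S b) = TD τ (V b)) (w : C2) :
    adjoint V w = (w 0 * cf V 0) • gv (wt τ 0) + (w 1 * cf V 1) • gv (wt τ 1) := by
  conv_lhs => rw [decomp_u w]
  rw [map_add, map_smul, map_smul, adjoint_u hτ hτ1 hVS 0, adjoint_u hτ hτ1 hVS 1, smul_smul, smul_smul]

/-- `(V b)_i = conj(c_i)·⟪g_{wt i}, b⟫`. [cite: Enflo2023, v2 (2) p.2] -/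
lemma apply_coord (hτ : 0 < τ) (hτ1 : τ < 1) (hVS : ∀ b, V (S b) = TD τ (V b)) (b : ℓ2) (i : Fin 2) :
    V b i = conj (cf V i) * ⟪gv (wt τ i), b⟫_ℂ := by
  rw [← inner_u_left, ← adjoint_inner_left, adjoint_u hτ hτ1 hVS i, inner_smul_left]

/-- THE GRAM CONSTANTS `G_{ik} = ⟪g_{wt i}, g_{wt k}⟫ = 1/(1 − wt_i wt_k)`. [folklore] -/
def G (τ : ℝ) (i k : Fin 2) : ℝ := (1 - wt τ i * wt τ k)⁻¹

/-- `⟪g_{wt i}, g_{wt k}⟫ = G_{ik}`. [folklore] -/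
lemma inner_gv_wt (hτ : 0 < τ) (hτ1 : τ < 1) (i k : Fin 2) :
    ⟪gv (wt τ i), gv (wt τ k)⟫_ℂ = ((G τ i k : ℝ) : ℂ) :=
  inner_gv_gv (abs_wt_lt hτ hτ1 i) (abs_wt_lt hτ hτ1 k)

/-- `G` is symmetric. [folklore] -/
lemma G_symm (τ : ℝ) (i k : Fin 2) : G τ i k = G τ k i := by rw [G, G, mul_comm]

/-- THE MATRIX OF `K = VV†`: `(V V† w)_i = conj(c_i)·(w₀c₀G_{i0} + w₁c₁G_{i1})`. [cite: Enflo2023, v2 (13)–(15) p.5] -/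
lemma K_apply (hτ : 0 < τ) (hτ1 : τ < 1) (hVS : ∀ b, V (S b) = TD τ (V b)) (w : C2) (i : Fin 2) :
    V (adjoint V w) i =
      conj (cf V i) * (w 0 * cf V 0 * ((G τ i 0 : ℝ) : ℂ) + w 1 * cf V 1 * ((G τ i 1 : ℝ) : ℂ)) := by
  rw [apply_coord hτ hτ1 hVS, adjoint_eq hτ hτ1 hVS, inner_add_right, inner_smul_right, inner_smul_right,
    inner_gv_wt hτ hτ1, inner_gv_wt hτ hτ1]

/-- `‖V†w‖² = G₀₀|ζ₀|² + 2G₀₁Re(ζ̄₀ζ₁) + G₁₁|ζ₁|²` with `ζ_i = w_i c_i`. [folklore] -/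
lemma norm_adjoint_sq (hτ : 0 < τ) (hτ1 : τ < 1) (hVS : ∀ b, V (S b) = TD τ (V b)) (w : C2) :
    ‖adjoint V w‖ ^ 2 = G τ 0 0 * ‖w 0 * cf V 0‖ ^ 2
      + 2 * G τ 0 1 * (conj (w 0 * cf V 0) * (w 1 * cf V 1)).re + G τ 1 1 * ‖w 1 * cf V 1‖ ^ 2 := by
  rw [adjoint_eq hτ hτ1 hVS w, norm_add_sq (𝕜 := ℂ), norm_smul, norm_smul, inner_smul_left, inner_smul_right,
    inner_gv_wt hτ hτ1, mul_pow, mul_pow, norm_gv_sq (abs_wt_lt hτ hτ1 0), norm_gv_sq (abs_wt_lt hτ hτ1 1)]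
  simp only [G, RCLike.re_to_complex]
  have e : ∀ a b : ℂ, ∀ r : ℝ, (a * (b * (r : ℂ))).re = r * (a * b).re := by
    intro a b r
    rw [← mul_assoc, Complex.mul_re, Complex.ofReal_re, Complex.ofReal_im, mul_zero, sub_zero, mul_comm]
  rw [e]
  ring

end intertwiner

/-! ### D. The state bound: at a true MC state, `0.0324·Δ·m₀m₁ ≤ (εθ)²(m₀G₀₀ + m₁G₁₁)²` -/

section statebound

variable {τ : ℝ} {W : ℓ2 →L[ℂ] C2} {x₀ z : C2}

/-- THE DISCRIMINANT `Δ := G₀₀G₁₁ − G₀₁²` (`= det` of the Gram matrix of `g_τ, g_{τ/2}`; `> 0` as `τ ≠ τ/2`). [folklore] -/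
def Δ (τ : ℝ) : ℝ := G τ 0 0 * G τ 1 1 - G τ 0 1 ^ 2

/-- `Δ > 0` for `0 < τ < 1` (Cauchy–Schwarz strict: `g_τ ∦ g_{τ/2}`), in closed form. [folklore] -/
lemma Δ_eq (τ : ℝ) (hτ1 : τ < 1) (hτ : 0 < τ) :
    Δ τ = (τ / 2) ^ 2 / ((1 - τ * τ) * (1 - τ / 2 * (τ / 2)) * (1 - τ * (τ / 2)) ^ 2) := by
  have h1 : (0 : ℝ) < 1 - τ * τ := by nlinarith
  have h2 : (0 : ℝ) < 1 - τ / 2 * (τ / 2) := by nlinarith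
  have h3 : (0 : ℝ) < 1 - τ * (τ / 2) := by nlinarith
  have i1 : (1 - τ * τ)⁻¹ * (1 - τ * τ) = 1 := inv_mul_cancel₀ h1.ne'
  have i2 : (1 - τ / 2 * (τ / 2))⁻¹ * (1 - τ / 2 * (τ / 2)) = 1 := inv_mul_cancel₀ h2.ne'
  have i3 : (1 - τ * (τ / 2))⁻¹ * (1 - τ * (τ / 2)) = 1 := inv_mul_cancel₀ h3.ne'
  rw [eq_div_iff (by positivity)]
  simp only [Δ, G, wt_zero, wt_one]
  calc ((1 - τ * τ)⁻¹ * (1 - τ / 2 * (τ / 2))⁻¹ - ((1 - τ * (τ / 2))⁻¹) ^ 2)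
        * ((1 - τ * τ) * (1 - τ / 2 * (τ / 2)) * (1 - τ * (τ / 2)) ^ 2)
      = ((1 - τ * τ)⁻¹ * (1 - τ * τ)) * ((1 - τ / 2 * (τ / 2))⁻¹ * (1 - τ / 2 * (τ / 2))) * (1 - τ * (τ / 2)) ^ 2
        - ((1 - τ * (τ / 2))⁻¹ * (1 - τ * (τ / 2))) ^ 2 * ((1 - τ * τ) * (1 - τ / 2 * (τ / 2))) := by ring
    _ = (τ / 2) ^ 2 := by rw [i1, i2, i3]; ring

/-- `0 < Δ`. [folklore] -/
lemma Δ_pos (hτ : 0 < τ) (hτ1 : τ < 1) : 0 < Δ τ := by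
  rw [Δ_eq τ hτ1 hτ]
  have h1 : (0 : ℝ) < 1 - τ * τ := by nlinarith
  have h2 : (0 : ℝ) < 1 - τ / 2 * (τ / 2) := by nlinarith
  have h3 : (0 : ℝ) < 1 - τ * (τ / 2) := by nlinarith
  positivity

/-- `1 ≤ G₁₁ ≤ G₀₀ ≤ 2` for `0 < τ ≤ 1/2`. [folklore] -/
lemma G_bounds (hτ : 0 < τ) (hτ1 : τ ≤ 1 / 2) :
    1 ≤ G τ 1 1 ∧ G τ 1 1 ≤ G τ 0 0 ∧ G τ 0 0 ≤ 2 ∧ 0 < G τ 0 1 := by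
  simp only [G, wt_zero, wt_one]
  have h1 : (1 : ℝ) / 2 ≤ 1 - τ * τ := by nlinarith
  have h2 : 1 - τ * τ ≤ 1 - τ / 2 * (τ / 2) := by nlinarith
  have h3 : 1 - τ / 2 * (τ / 2) ≤ 1 := by nlinarith
  have h4 : (0 : ℝ) < 1 - τ * (τ / 2) := by nlinarith
  refine ⟨?_, ?_, ?_, inv_pos.2 h4⟩
  · rw [le_inv_comm₀ (by norm_num) (by linarith), inv_one]; exact h3
  · exact inv_anti₀ (by linarith) h2
  · rw [inv_le_comm₀ (by linarith) (by norm_num)]; linarith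

/-- the Cayley–Hamilton identity behind the state bound, as polynomial algebra: with `E = ‖V†w‖²`,
`N = ‖VV†w‖²`, `Z' = m₀|ζ₁|² + m₁|ζ₀|²` one has `tr K · E = N + det K · ‖w‖²`. [folklore] -/
lemma ch_identity (A₀ A₁ B m₀ m₁ a b r : ℝ) :
    (m₀ * A₀ + m₁ * A₁) * (A₀ * a + 2 * B * r + A₁ * b) =
      (m₀ * (A₀ ^ 2 * a + 2 * (A₀ * B) * r + B ^ 2 * b) + m₁ * (B ^ 2 * a + 2 * (B * A₁) * r + A₁ ^ 2 * b))
        + (A₀ * A₁ - B ^ 2) * (m₀ * b + m₁ * a) := by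
  ring

/-- `|αr + βs·|²`-expansion in `ℂ`: `‖(p:ℂ)ζ₀ + (q:ℂ)ζ₁‖² = p²|ζ₀|² + 2pq Re(ζ̄₀ζ₁) + q²|ζ₁|²`. [folklore] -/
lemma norm_sq_lin (p q : ℝ) (ζ₀ ζ₁ : ℂ) :
    ‖(p : ℂ) * ζ₀ + (q : ℂ) * ζ₁‖ ^ 2 = p ^ 2 * ‖ζ₀‖ ^ 2 + 2 * (p * q) * (conj ζ₀ * ζ₁).re + q ^ 2 * ‖ζ₁‖ ^ 2 := by
  rw [Complex.sq_norm, Complex.sq_norm, Complex.sq_norm]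
  simp only [Complex.normSq_apply, Complex.add_re, Complex.add_im, Complex.mul_re, Complex.mul_im,
    Complex.ofReal_re, Complex.ofReal_im, Complex.conj_re, Complex.conj_im]
  ring

/-- the real arithmetic of the state bound: `T·E = N + D·P·Z`, `N, Z ≥ 0.09` `⟹ 0.0324·D·P ≤ E²T²`. [folklore] -/
lemma bound_of_identity {T E N Z D P : ℝ} (hCH : T * E = N + D * (P * Z)) (hN : 0.09 ≤ N) (hZ : 0.09 ≤ Z)
    (hD : 0 ≤ D) (hP : 0 ≤ P) : 0.0324 * D * P ≤ E ^ 2 * T ^ 2 := by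
  have hDP : 0 ≤ D * P := mul_nonneg hD hP
  have hlow : 0.09 * (1 + D * P) ≤ T * E := by rw [hCH]; nlinarith
  have e1 : E ^ 2 * T ^ 2 = (T * E) * (T * E) := by ring
  rw [e1]
  have hsq := mul_self_le_mul_self (by positivity) hlow
  nlinarith [sq_nonneg (1 - D * P)]

/-- **CAYLEY–HAMILTON AT A BRACKET POINT.**  For an intertwiner `W` and `z + WW†z = x₀`:
`(m₀G₀₀ + m₁G₁₁)·‖W†z‖² = ‖x₀ − z‖² + Δ·m₀m₁·‖z‖²` (`m_i = |c_i|²`), i.e. `tr K·⟨z,Kz⟩ = ‖Kz‖² + det K·‖z‖²`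
for the rank-2 positive `K = WW†` with `tr K = m₀G₀₀ + m₁G₁₁`, `det K = m₀m₁Δ`. [cite: Enflo2023, v2 (15)–(16) p.5–6] -/
theorem ch_bracket (hτ : 0 < τ) (hτ1 : τ < 1) (hWS : ∀ b, W (S b) = TD τ (W b)) (hz : IsBracket W x₀ z) :
    (‖cf W 0‖ ^ 2 * G τ 0 0 + ‖cf W 1‖ ^ 2 * G τ 1 1) * ‖adjoint W z‖ ^ 2 =
      ‖x₀ - z‖ ^ 2 + Δ τ * (‖cf W 0‖ ^ 2 * ‖cf W 1‖ ^ 2 * ‖z‖ ^ 2) := by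
  have hEeq := norm_adjoint_sq hτ hτ1 hWS z
  have hz' : z + W (adjoint W z) = x₀ := hz
  have hK : x₀ - z = W (adjoint W z) := by rw [← hz']; abel
  have hK0 : (x₀ - z) 0 = conj (cf W 0) * (((G τ 0 0 : ℝ) : ℂ) * (z 0 * cf W 0) + ((G τ 0 1 : ℝ) : ℂ) * (z 1 * cf W 1)) := by
    rw [hK, K_apply hτ hτ1 hWS]; ring
  have hK1 : (x₀ - z) 1 = conj (cf W 1) * (((G τ 0 1 : ℝ) : ℂ) * (z 0 * cf W 0) + ((G τ 1 1 : ℝ) : ℂ) * (z 1 * cf W 1)) := by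
    rw [hK, K_apply hτ hτ1 hWS, G_symm τ 1 0]; ring
  have hN : ‖x₀ - z‖ ^ 2 =
      ‖cf W 0‖ ^ 2 * (G τ 0 0 ^ 2 * ‖z 0 * cf W 0‖ ^ 2
        + 2 * (G τ 0 0 * G τ 0 1) * (conj (z 0 * cf W 0) * (z 1 * cf W 1)).re + G τ 0 1 ^ 2 * ‖z 1 * cf W 1‖ ^ 2)
      + ‖cf W 1‖ ^ 2 * (G τ 0 1 ^ 2 * ‖z 0 * cf W 0‖ ^ 2
        + 2 * (G τ 0 1 * G τ 1 1) * (conj (z 0 * cf W 0) * (z 1 * cf W 1)).re + G τ 1 1 ^ 2 * ‖z 1 * cf W 1‖ ^ 2) := by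
    rw [← norm_sq_C2, hK0, hK1, norm_mul, norm_mul, mul_pow, mul_pow, norm_sq_lin, norm_sq_lin,
      RCLike.norm_conj, RCLike.norm_conj]
  have hZ : ‖cf W 0‖ ^ 2 * ‖z 1 * cf W 1‖ ^ 2 + ‖cf W 1‖ ^ 2 * ‖z 0 * cf W 0‖ ^ 2 =
      ‖cf W 0‖ ^ 2 * ‖cf W 1‖ ^ 2 * ‖z‖ ^ 2 := by
    rw [← norm_sq_C2, norm_mul, norm_mul]; ring
  rw [hEeq, ch_identity, ← hN, Δ, hZ]

/-- **THE STATE BOUND.**  At a bracket point `z + WW†z = x₀` of an intertwiner `W` with `‖z‖ ≥ 0.3` and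
`‖x₀ − z‖ ≥ 0.3` (true at every MC state, `State.window`, `norm_x₀_sub_v_ge`):
`0.0324·Δ·m₀m₁ ≤ (‖W†z‖²)²·(m₀G₀₀ + m₁G₁₁)²`, `m_i = |c_i|²` (from `ch_bracket`).  So `(εθ) = ‖W†z‖²` small forces
the scale-free ratio `m₀m₁/(m₀ + m₁)²` small: one of the two eigen-components of `y` must die out. [cite: Enflo2023, v2 (15)–(16) p.5–6; (32) p.15] -/
theorem state_bound (hτ : 0 < τ) (hτ1 : τ < 1) (hWS : ∀ b, W (S b) = TD τ (W b)) (hz : IsBracket W x₀ z)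
    (hz3 : (0.3 : ℝ) ≤ ‖z‖) (hxz : (0.3 : ℝ) ≤ ‖x₀ - z‖) :
    0.0324 * Δ τ * (‖cf W 0‖ ^ 2 * ‖cf W 1‖ ^ 2) ≤
      (‖adjoint W z‖ ^ 2) ^ 2 * (‖cf W 0‖ ^ 2 * G τ 0 0 + ‖cf W 1‖ ^ 2 * G τ 1 1) ^ 2 :=
  bound_of_identity (ch_bracket hτ hτ1 hWS hz) (by nlinarith) (by nlinarith) (Δ_pos hτ hτ1).le (by positivity)

/-- THE SCALE-FREE POTENTIAL `cyc(W) := m₀m₁/(m₀ + m₁)²` (`∈ [0, ¼]`; `= 0` iff an eigen-component of `y` vanishes). [folklore] -/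
def cyc (W : ℓ2 →L[ℂ] C2) : ℝ := ‖cf W 0‖ ^ 2 * ‖cf W 1‖ ^ 2 / (‖cf W 0‖ ^ 2 + ‖cf W 1‖ ^ 2) ^ 2

/-- the real arithmetic of `cyc_le`. [folklore] -/
lemma cyc_arith {m₀ m₁ A₀ A₁ D E2 : ℝ} (hm₀ : 0 ≤ m₀) (hm₁ : 0 ≤ m₁) (h1 : A₁ ≤ A₀) (h2 : A₀ ≤ 2) (h0 : 0 ≤ A₁)
    (hE : 0 ≤ E2) (hb : 0.0324 * D * (m₀ * m₁) ≤ E2 * (m₀ * A₀ + m₁ * A₁) ^ 2) :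
    0.0081 * D * (m₀ * m₁ / (m₀ + m₁) ^ 2) ≤ E2 := by
  by_cases hsum : m₀ + m₁ = 0
  · have hm : m₀ = 0 := by linarith
    rw [hm, zero_mul, zero_div, mul_zero]; exact hE
  have hsp : 0 < (m₀ + m₁) ^ 2 := by positivity
  rw [← mul_div_assoc, div_le_iff₀ hsp]
  have htr : (m₀ * A₀ + m₁ * A₁) ^ 2 ≤ 4 * (m₀ + m₁) ^ 2 := by
    have h3 : m₀ * A₀ + m₁ * A₁ ≤ 2 * (m₀ + m₁) := by nlinarith
    have h4 : 0 ≤ m₀ * A₀ + m₁ * A₁ := by nlinarith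
    nlinarith
  nlinarith [mul_le_mul_of_nonneg_left htr hE]

/-- COROLLARY: `0.0081·Δ·cyc(W) ≤ (εθ)²` at every admissible bracket point (uses `G₁₁ ≤ G₀₀ ≤ 2`, `τ ≤ ½`).
[cite: Enflo2023, v2 (16) p.6; (32) p.15] -/
theorem cyc_le (hτ : 0 < τ) (hτ1 : τ ≤ 1 / 2) (hWS : ∀ b, W (S b) = TD τ (W b)) (hz : IsBracket W x₀ z)
    (hz3 : (0.3 : ℝ) ≤ ‖z‖) (hxz : (0.3 : ℝ) ≤ ‖x₀ - z‖) :
    0.0081 * Δ τ * cyc W ≤ (‖adjoint W z‖ ^ 2) ^ 2 := by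
  obtain ⟨h11, h10, h02, -⟩ := G_bounds hτ hτ1
  exact cyc_arith (by positivity) (by positivity) h10 h02 (by linarith) (by positivity) (by simpa only [mul_comm] using state_bound hτ (by linarith) hWS hz hz3 hxz)

end statebound


/-! ### E. One admissible step `W → W(1 + N)`, `N ∈ {S}'`: `c_i ↦ c_i(1 + n_i)` with `|n₀ − n₁| ≤ 2‖N‖τ` -/

section commstep

variable {τ : ℝ} {V : ℓ2 →L[ℂ] C2} {N : ℓ2 →L[ℂ] ℓ2}

/-- THE EIGENVALUE `n_μ := (N†g_μ)₀` of `N† ∈ {S†}'` on `g_μ` (for `N = r(S)`, `r` a polynomial: `n_μ = conj r(μ)` —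
the text's `y → y + r(T)y` multiplies the `T†`-eigencomponents of `V_y†` by `1 + r(t_i)`). [cite: Enflo2023, v2 p.16] -/
def ev (N : ℓ2 →L[ℂ] ℓ2) (μ : ℝ) : ℂ := adjoint N (gv μ) 0

/-- coordinates of `N†a`. [folklore] -/
lemma adjointN_apply_coord (N : ℓ2 →L[ℂ] ℓ2) (a : ℓ2) (k : ℕ) : adjoint N a k = ⟪N (e k), a⟫_ℂ := by
  rw [← inner_e_left, adjoint_inner_right]

/-- `{S}'` ACTS ON EACH `g_μ` BY A SCALAR: `NS = SN ⟹ N†g_μ = n_μ·g_μ`. [folklore] -/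
lemma adjoint_gv_of_comm (hN : N ∘L S = S ∘L N) {μ : ℝ} (hμ : |μ| < 1) : adjoint N (gv μ) = ev N μ • gv μ := by
  apply lp.ext
  funext k
  rw [lp.coeFn_smul, Pi.smul_apply, smul_eq_mul, gv_apply hμ]
  induction k with
  | zero => rw [pow_zero, mul_one]; rfl
  | succ k ih =>
    have hc : N (S (e k)) = S (N (e k)) := by
      have := congrArg (fun A : ℓ2 →L[ℂ] ℓ2 => A (e k)) hN
      simpa using this
    rw [adjointN_apply_coord, ← S_e, hc, ← inner_conj_symm, inner_gv_S hμ, map_mul, Complex.conj_ofReal,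
      inner_conj_symm, ← adjointN_apply_coord, ih, pow_succ]
    ring

/-- `|n_μ| ≤ ‖N‖`. [folklore] -/
lemma norm_ev_le (hN : N ∘L S = S ∘L N) {μ : ℝ} (hμ : |μ| < 1) : ‖ev N μ‖ ≤ ‖N‖ := by
  have h1 : ‖adjoint N (gv μ)‖ = ‖ev N μ‖ * ‖gv μ‖ := by rw [adjoint_gv_of_comm hN hμ, norm_smul]
  have h2 : ‖adjoint N (gv μ)‖ ≤ ‖N‖ * ‖gv μ‖ := by
    have := (adjoint N).le_opNorm (gv μ)
    rwa [LinearIsometryEquiv.norm_map] at this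
  have hg := one_le_norm_gv hμ
  rw [h1] at h2
  exact le_of_mul_le_mul_right h2 (by linarith)

/-- `|n_μ − n_ν| ≤ 2‖N‖·‖g_μ − g_ν‖` (from `(n_μ − n_ν)g_μ = N†(g_μ − g_ν) + n_ν(g_ν − g_μ)`, `‖g_μ‖ ≥ 1`). [folklore] -/
lemma norm_ev_sub_le (hN : N ∘L S = S ∘L N) {μ ν : ℝ} (hμ : |μ| < 1) (hν : |ν| < 1) :
    ‖ev N μ - ev N ν‖ ≤ 2 * ‖N‖ * ‖gv μ - gv ν‖ := by
  have hid : (ev N μ - ev N ν) • gv μ = adjoint N (gv μ - gv ν) + ev N ν • (gv ν - gv μ) := by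
    rw [map_sub, adjoint_gv_of_comm hN hμ, adjoint_gv_of_comm hN hν, sub_smul, smul_sub]
    abel
  have h1 : ‖ev N μ - ev N ν‖ * ‖gv μ‖ ≤ ‖N‖ * ‖gv μ - gv ν‖ + ‖ev N ν‖ * ‖gv μ - gv ν‖ := by
    rw [← norm_smul, hid]
    refine (norm_add_le _ _).trans (add_le_add ?_ ?_)
    · have := (adjoint N).le_opNorm (gv μ - gv ν)
      rwa [LinearIsometryEquiv.norm_map] at this
    · rw [norm_smul, ← norm_neg (gv ν - gv μ), neg_sub]
  have h2 : ‖ev N ν‖ * ‖gv μ - gv ν‖ ≤ ‖N‖ * ‖gv μ - gv ν‖ :=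
    mul_le_mul_of_nonneg_right (norm_ev_le hN hν) (norm_nonneg _)
  have hg := one_le_norm_gv hμ
  have h3 : ‖ev N μ - ev N ν‖ ≤ ‖ev N μ - ev N ν‖ * ‖gv μ‖ := le_mul_of_one_le_right (norm_nonneg _) hg
  linarith

/-- `‖g_τ − g_{τ/2}‖ ≤ τ` for `0 < τ ≤ ½` (`‖g_τ − g_{τ/2}‖² = (τ²/4)(1 + τ²/2)/((1−τ²)(1−τ²/4)(1−τ²/2))`). [folklore] -/
lemma norm_gv_sub_le (hτ : 0 < τ) (hτ1 : τ ≤ 1 / 2) : ‖gv (wt τ 0) - gv (wt τ 1)‖ ≤ τ := by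
  have hlt : τ < 1 := by linarith
  have a0 := abs_wt_lt hτ hlt 0
  have a1 := abs_wt_lt hτ hlt 1
  have hsq : ‖gv (wt τ 0) - gv (wt τ 1)‖ ^ 2 = G τ 0 0 - 2 * G τ 0 1 + G τ 1 1 := by
    rw [norm_sub_sq (𝕜 := ℂ), inner_gv_wt hτ hlt, norm_gv_sq a0, norm_gv_sq a1]
    simp only [G, RCLike.re_to_complex, Complex.ofReal_re]
  have h1 : (0 : ℝ) < 1 - τ * τ := by nlinarith
  have h2 : (0 : ℝ) < 1 - τ / 2 * (τ / 2) := by nlinarith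
  have h3 : (0 : ℝ) < 1 - τ * (τ / 2) := by nlinarith
  have i1 : (1 - τ * τ)⁻¹ * (1 - τ * τ) = 1 := inv_mul_cancel₀ h1.ne'
  have i2 : (1 - τ / 2 * (τ / 2))⁻¹ * (1 - τ / 2 * (τ / 2)) = 1 := inv_mul_cancel₀ h2.ne'
  have i3 : (1 - τ * (τ / 2))⁻¹ * (1 - τ * (τ / 2)) = 1 := inv_mul_cancel₀ h3.ne'
  have hX : (G τ 0 0 - 2 * G τ 0 1 + G τ 1 1) * ((1 - τ * τ) * (1 - τ / 2 * (τ / 2)) * (1 - τ * (τ / 2)))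
      = τ * τ / 4 * (1 + τ * τ / 2) := by
    simp only [G, wt_zero, wt_one]
    calc ((1 - τ * τ)⁻¹ - 2 * (1 - τ * (τ / 2))⁻¹ + (1 - τ / 2 * (τ / 2))⁻¹)
          * ((1 - τ * τ) * (1 - τ / 2 * (τ / 2)) * (1 - τ * (τ / 2)))
        = ((1 - τ * τ)⁻¹ * (1 - τ * τ)) * ((1 - τ / 2 * (τ / 2)) * (1 - τ * (τ / 2)))
          - 2 * ((1 - τ * (τ / 2))⁻¹ * (1 - τ * (τ / 2))) * ((1 - τ * τ) * (1 - τ / 2 * (τ / 2)))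
          + ((1 - τ / 2 * (τ / 2))⁻¹ * (1 - τ / 2 * (τ / 2))) * ((1 - τ * τ) * (1 - τ * (τ / 2))) := by ring
      _ = τ * τ / 4 * (1 + τ * τ / 2) := by rw [i1, i2, i3]; ring
  have hden : (0 : ℝ) < (1 - τ * τ) * (1 - τ / 2 * (τ / 2)) * (1 - τ * (τ / 2)) := by positivity
  have hle : G τ 0 0 - 2 * G τ 0 1 + G τ 1 1 ≤ τ ^ 2 := by
    refine le_of_not_gt fun hgt => ?_
    have := mul_lt_mul_of_pos_right hgt hden
    rw [hX] at this
    have ht0 : 0 ≤ τ * τ := by positivity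
    have ht2 : τ * τ ≤ 1 / 4 := by nlinarith
    have hA : (1 : ℝ) + τ * τ / 2 ≤ 4 * ((1 - τ * τ) * (1 - τ / 2 * (τ / 2)) * (1 - τ * (τ / 2))) := by
      nlinarith [mul_nonneg ht0 ht0, mul_nonneg (mul_nonneg ht0 ht0) ht0, mul_le_mul_of_nonneg_left ht2 ht0,
        mul_le_mul_of_nonneg_left ht2 (mul_nonneg ht0 ht0)]
    have hB : τ * τ / 4 * (1 + τ * τ / 2) ≤
        τ ^ 2 * ((1 - τ * τ) * (1 - τ / 2 * (τ / 2)) * (1 - τ * (τ / 2))) := by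
      rw [pow_two]; nlinarith [mul_le_mul_of_nonneg_left hA ht0]
    linarith
  rw [← hsq] at hle
  exact pow_le_pow_iff_left₀ (norm_nonneg _) hτ.le two_ne_zero |>.1 hle

/-- THE STEP ON COEFFICIENTS: `c_i(W(1+N)) = c_i(W)·(1 + n_{wt i})`. [cite: Enflo2023, v2 p.16 (`y → y + r(T)y`)] -/
lemma cf_comp (hτ : 0 < τ) (hτ1 : τ < 1) (hVS : ∀ b, V (S b) = TD τ (V b)) (N : ℓ2 →L[ℂ] ℓ2) (i : Fin 2) :
    cf (V ∘L (1 + N)) i = cf V i * (1 + ev N (wt τ i)) := by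
  have a := abs_wt_lt hτ hτ1 i
  rw [cf, adjoint_apply_coord, comp_apply, ← adjoint_inner_right, adjoint_u hτ hτ1 hVS i, inner_smul_right,
    add_apply, one_apply_eq_self, inner_add_left, inner_e_left, gv_zero a, ← adjoint_inner_right,
    inner_e_left]
  rfl

/-- scaling: `c_i(r·W) = conj r · c_i(W)`. [folklore] -/
lemma cf_smul (r : ℂ) (V : ℓ2 →L[ℂ] C2) (i : Fin 2) : cf (r • V) i = conj r * cf V i := by
  rw [cf, cf, adjoint_apply_coord, adjoint_apply_coord, smul_apply, inner_smul_left]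

/-- `cyc` is scale-invariant. [folklore] -/
lemma cyc_smul {r : ℂ} (hr : r ≠ 0) (V : ℓ2 →L[ℂ] C2) : cyc (r • V) = cyc V := by
  have hr2 : (0 : ℝ) < ‖r‖ ^ 2 := by positivity
  simp only [cyc, cf_smul, norm_mul, RCLike.norm_conj, mul_pow]
  by_cases h0 : ‖cf V 0‖ ^ 2 + ‖cf V 1‖ ^ 2 = 0
  · have e : ‖r‖ ^ 2 * ‖cf V 0‖ ^ 2 + ‖r‖ ^ 2 * ‖cf V 1‖ ^ 2 = 0 := by rw [← mul_add, h0, mul_zero]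
    rw [h0, e]; simp
  rw [div_eq_div_iff (by rw [← mul_add]; exact pow_ne_zero _ (mul_ne_zero hr2.ne' h0)) (pow_ne_zero _ h0)]
  ring

/-- the real arithmetic of one step of `cyc`: if `q₀ ≤ ρq₁`, `q₁ ≤ ρq₀` then
`m₀m₁/(m₀+m₁)² ≤ ρ · (m₀q₀)(m₁q₁)/(m₀q₀ + m₁q₁)²`. [folklore] -/
lemma cyc_step_arith {m₀ m₁ q₀ q₁ ρ : ℝ} (hm₀ : 0 < m₀) (hm₁ : 0 < m₁) (hq₀ : 0 < q₀) (hq₁ : 0 < q₁)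
    (h₀ : q₀ ≤ ρ * q₁) (h₁ : q₁ ≤ ρ * q₀) :
    m₀ * m₁ / (m₀ + m₁) ^ 2 ≤ ρ * (m₀ * q₀ * (m₁ * q₁) / (m₀ * q₀ + m₁ * q₁) ^ 2) := by
  have hρ : 1 ≤ ρ := by nlinarith
  have hd1 : 0 < (m₀ + m₁) ^ 2 := by positivity
  have hd2 : 0 < (m₀ * q₀ + m₁ * q₁) ^ 2 := by positivity
  rw [← mul_div_assoc, div_le_div_iff₀ hd1 hd2]
  have k0 : 0 ≤ m₀ ^ 2 * (q₀ * (ρ * q₁ - q₀)) := by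
    have : 0 ≤ ρ * q₁ - q₀ := by linarith
    positivity
  have k1 : 0 ≤ m₁ ^ 2 * (q₁ * (ρ * q₀ - q₁)) := by
    have : 0 ≤ ρ * q₀ - q₁ := by linarith
    positivity
  have k2 : 0 ≤ m₀ * m₁ * q₀ * q₁ * (ρ - 1) := by
    have : 0 ≤ ρ - 1 := by linarith
    positivity
  nlinarith [mul_pos hm₀ hm₁]

/-- the ratio control of the two multipliers: `|n_i| ≤ ν ≤ ½`, `|n₀ − n₁| ≤ d ⟹ |1+n₁|² ≤ (1+2d)²|1+n₀|²`. [folklore] -/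
lemma mult_ratio {n₀ n₁ : ℂ} {ν d : ℝ} (hν : ν ≤ 1 / 2) (h0 : ‖n₀‖ ≤ ν) (hd : ‖n₀ - n₁‖ ≤ d) :
    ‖1 + n₁‖ ^ 2 ≤ (1 + 2 * d) ^ 2 * ‖1 + n₀‖ ^ 2 := by
  have hd0 : 0 ≤ d := (norm_nonneg _).trans hd
  have hlow : 1 / 2 ≤ ‖1 + n₀‖ := by
    have := norm_sub_le_norm_add (1 : ℂ) n₀
    rw [norm_one] at this
    have h' : ‖(1 : ℂ) - n₀‖ ≥ 1 - ‖n₀‖ := by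
      have := norm_sub_norm_le (1 : ℂ) n₀
      rw [norm_one] at this
      linarith [abs_sub_abs_le_abs_sub ‖(1:ℂ)‖ ‖n₀‖, norm_sub_rev (1 : ℂ) n₀]
    have h'' : 1 - ‖n₀‖ ≤ ‖1 + n₀‖ := by
      have := norm_le_norm_add_norm_sub' (1 : ℂ) n₀
      have t := abs_norm_sub_norm_le (1 : ℂ) (-n₀)
      rw [norm_neg, sub_neg_eq_add, norm_one] at t
      linarith [(abs_le.1 t).1, (abs_le.1 t).2, le_abs_self (1 - ‖n₀‖)]
    linarith
  have hup : ‖1 + n₁‖ ≤ ‖1 + n₀‖ + d := by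
    have e : (1 : ℂ) + n₁ = (1 + n₀) - (n₀ - n₁) := by ring
    rw [e]
    exact (norm_sub_le _ _).trans (by linarith)
  have hup' : ‖1 + n₁‖ ≤ (1 + 2 * d) * ‖1 + n₀‖ := by nlinarith
  rw [← mul_pow]
  exact pow_le_pow_left₀ (norm_nonneg _) hup' 2

/-- **ONE STEP OF THE POTENTIAL**: for an intertwiner `V` with `c₀c₁ ≠ 0` and an admissible `N ∈ {S}'` with
`‖N‖ ≤ ν ≤ ½`: the new intertwiner `V(1+N)` has `c_i' = c_i(1+n_i) ≠ 0` and `cyc(V) ≤ (1 + 4ντ)²·cyc(V(1+N))`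
(`|n₀ − n₁| ≤ 2ντ` because the two eigenvalues of `T_τ` are `τ/2` apart and `g_τ ≈ g_{τ/2}`).
[cite: Enflo2023, v2 (35) p.16, p.16–17] -/
theorem cyc_step (hτ : 0 < τ) (hτ1 : τ ≤ 1 / 2) (hVS : ∀ b, V (S b) = TD τ (V b)) (hN : N ∘L S = S ∘L N)
    {ν : ℝ} (hNν : ‖N‖ ≤ ν) (hν : ν ≤ 1 / 2) (h0 : cf V 0 ≠ 0) (h1 : cf V 1 ≠ 0) :
    cf (V ∘L (1 + N)) 0 ≠ 0 ∧ cf (V ∘L (1 + N)) 1 ≠ 0 ∧ cyc V ≤ (1 + 4 * ν * τ) ^ 2 * cyc (V ∘L (1 + N)) := by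
  have hlt : τ < 1 := by linarith
  have a0 := abs_wt_lt hτ hlt 0
  have a1 := abs_wt_lt hτ hlt 1
  have hn0 : ‖ev N (wt τ 0)‖ ≤ ν := (norm_ev_le hN a0).trans hNν
  have hn1 : ‖ev N (wt τ 1)‖ ≤ ν := (norm_ev_le hN a1).trans hNν
  have hd : ‖ev N (wt τ 0) - ev N (wt τ 1)‖ ≤ 2 * ν * τ := by
    refine (norm_ev_sub_le hN a0 a1).trans ?_
    have := norm_gv_sub_le hτ hτ1
    have hN0 := norm_nonneg N
    calc 2 * ‖N‖ * ‖gv (wt τ 0) - gv (wt τ 1)‖ ≤ 2 * ‖N‖ * τ := by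
          exact mul_le_mul_of_nonneg_left this (by positivity)
      _ ≤ 2 * ν * τ := by nlinarith
  have hd' : ‖ev N (wt τ 1) - ev N (wt τ 0)‖ ≤ 2 * ν * τ := by rwa [norm_sub_rev]
  have hne : ∀ n : ℂ, ‖n‖ ≤ ν → 1 + n ≠ 0 := by
    intro n hn h
    have : n = -1 := by linear_combination h
    rw [this, norm_neg, norm_one] at hn
    linarith
  rw [cf_comp hτ hlt hVS N 0, cf_comp hτ hlt hVS N 1]
  refine ⟨mul_ne_zero h0 (hne _ hn0), mul_ne_zero h1 (hne _ hn1), ?_⟩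
  have q01 := mult_ratio hν hn0 hd
  have q10 := mult_ratio hν hn1 hd'
  simp only [cyc, cf_comp hτ hlt hVS N, norm_mul, mul_pow]
  have e : (1 + 2 * (2 * ν * τ)) ^ 2 = (1 + 4 * ν * τ) ^ 2 := by ring
  rw [e] at q01 q10
  exact cyc_step_arith (by positivity) (by positivity) (pow_pos (norm_pos_iff.2 (hne _ hn0)) 2)
    (pow_pos (norm_pos_iff.2 (hne _ hn1)) 2) q10 q01

end commstep


/-! ### F. Along the run: `IndepRunκ T_τ x₀ S (ιS S) σ β s₀` forces `(εθ)₀ = 0` -/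

section run

variable {τ : ℝ} {x₀ : C2}

/-- every state's `V` intertwines: `V(Sb) = T_τ(Vb)` ((31)). [cite: Enflo2023, v2 (2)–(4) p.2, (31) p.16] -/
lemma state_intertwine (s : State (TD τ) x₀ S) (b : ℓ2) : s.V (S b) = TD τ (s.V b) := s.hVS b

/-- … and so does its normalised operator `Wn s`. [cite: Enflo2023, v2 (5)–(6) p.3] -/
lemma Wn_intertwine (s : State (TD τ) x₀ S) (b : ℓ2) : Wn s (S b) = TD τ (Wn s b) := by
  rw [Wn, smul_apply, smul_apply, state_intertwine, map_smul]

/-- `Wn s` is a NON-ZERO multiple of `s.V` (when `(εθ) > 0`). [cite: Enflo2023, v2 (5)–(6) p.3] -/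
lemma Wn_eq_smul (hx₀ : ‖x₀‖ = 1) (s : State (TD τ) x₀ S) (he : 0 < s.etheta) :
    ∃ r : ℂ, r ≠ 0 ∧ Wn s = r • s.V := by
  refine ⟨_, ?_, rfl⟩
  have hne : s.a ≠ 0 := s.hmin.ne_zero (s.eps_lt hx₀)
  have hpos : 0 < Real.sqrt (‖s.a‖ ^ 2 / s.etheta) := Real.sqrt_pos.2 (div_pos (by positivity) he)
  exact_mod_cast hpos.ne'

/-- **Degenerate case.**  If `c₀ = 0` or `c₁ = 0` (one eigen-component of `y` vanishes: `y` is an eigenvector of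
`T_τ†`-type data), then `range W† ⊆ ℂ·g`, so `ℓ ∥ κ(x₀ − z)` and `indepBrκ_self_le` forces `ℓ = 0`: the intrinsic
independence (34) fails at the self-pivot. [cite: Enflo2023, v2 (34)–(38) p.16–17] -/
theorem not_indepBrκ_of_degenerate (hτ : 0 < τ) (hτ1 : τ < 1) {W : ℓ2 →L[ℂ] C2}
    (hWS : ∀ b, W (S b) = TD τ (W b)) (hc : cf W 0 = 0 ∨ cf W 1 = 0) (x₀ : C2) {σ : ℝ} (hσ : 0 < σ) :
    ¬ IndepBrκ W x₀ (x₀ - bz W x₀) (ιS S) σ := by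
  intro h
  obtain ⟨hA, hκ⟩ := h.ne_zero
  obtain ⟨k, hk⟩ : ∃ k : Fin 2, ∀ w : C2, adjoint W w = (w k * cf W k) • gv (wt τ k) := by
    rcases hc with h0 | h1
    · exact ⟨1, fun w => by rw [adjoint_eq hτ hτ1 hWS, h0, mul_zero, zero_smul, zero_add]⟩
    · exact ⟨0, fun w => by rw [adjoint_eq hτ hτ1 hWS, h1, mul_zero, zero_smul, add_zero]⟩
  have hℓ : ba W x₀ = ((bz W x₀) k * cf W k) • gv (wt τ k) := hk _
  have hκ' : bκ W (x₀ - bz W x₀) = ((brInv W (x₀ - bz W x₀)) k * cf W k) • gv (wt τ k) := hk _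
  set α : ℂ := (bz W x₀) k * cf W k
  set α' : ℂ := (brInv W (x₀ - bz W x₀)) k * cf W k
  have hα' : α' ≠ 0 := by
    intro h0
    apply hκ
    rw [hκ', h0, zero_smul]
  have hι1 : ∀ p : Comm S, ‖ιS S p‖ ≤ ‖p‖ := (ιS_props S).2.1
  have hle := indepBrκ_self_le W x₀ (ιS S) hσ hι1 h (α / α')
  have hzero : ba W x₀ - (α / α') • bκ W (x₀ - bz W x₀) = 0 := by
    rw [hℓ, hκ', smul_smul, div_mul_cancel₀ _ hα', sub_self]
  rw [hzero, norm_zero, mul_zero] at hle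
  have h0 : ‖ba W x₀‖ ≤ 0 := by
    by_contra hpos
    linarith [mul_pos hσ (lt_of_not_ge hpos)]
  exact hA (norm_le_zero_iff.1 h0)

/-- arithmetic of the endgame: `rⁿ·E < c` eventually. [folklore] -/
lemma exists_pow_mul_lt {r E c : ℝ} (hr0 : 0 ≤ r) (hr1 : r < 1) (hc : 0 < c) : ∃ n : ℕ, r ^ n * E < c := by
  have ht := (tendsto_pow_atTop_nhds_zero_of_lt_one hr0 hr1).mul_const E
  rw [zero_mul] at ht
  obtain ⟨N, hN⟩ := eventually_atTop.1 (ht.eventually_lt_const hc)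
  exact ⟨N, hN N le_rfl⟩

/-- **THE RUN-LEVEL HYPOTHESIS FAILS IN THE TYPE-1 MODEL (quantitative form): `IndepRunκ T_τ x₀ S (ιS S) σ β s₀`
forces `(εθ)₀ = 0`** (`0 < τ ≤ σ/100`).  Every reachable state is its own pivot, so (34) holds along the run that
`exists_state_stepκ` itself builds; along it `(εθ)_n = (1−β)ⁿ(εθ)₀` while each admissible step `N ∈ {S}'`,
`‖N‖ ≤ 2β/σ`, multiplies the two eigen-coefficients by `1 + n_i` with `|n₀ − n₁| ≤ 4βτ/σ` (`cyc_step`), so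
`cyc_n ≥ cyc₀·(1 + 8βτ/σ)^{-2n}`; but `cyc_le` gives `0.0081·Δ·cyc_n ≤ (εθ)_n²`, i.e.
`0.0081·Δ·cyc₀ ≤ ((1−β)(1+8βτ/σ))^{2n}(εθ)₀² → 0` — absurd.  A degenerate start dies at once
(`not_indepBrκ_of_degenerate`).  The contraction `(1−β)` of (35) beats the only rate `8βτ/σ ≤ 0.08β` at which
admissible steps can separate the two eigen-components: THE DYNAMICS (35)/(45) CANNOT KILL A COMPONENT, (16)
SAYS ONE MUST DIE. [cite: Enflo2023, v2 (34)–(35) p.16; (45)–(46) p.19; p.19–20] -/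
theorem indepRunκ_etheta_eq_zero (hτ : 0 < τ) (hx₀ : ‖x₀‖ = 1) {σ β : ℝ} (hσ : 0 < σ) (hσ1 : σ ≤ 1)
    (hτσ : τ ≤ σ / 100) (hβ0 : 0 < β) (hβ : β ≤ σ ^ 2 / 1000) (s₀ : State (TD τ) x₀ S)
    (hstart : (0.09 : ℝ) + (22 / σ + 1) * s₀.etheta ≤ s₀.ε ^ 2 ∧
      s₀.ε ^ 2 + (22 / σ + 1) * s₀.etheta ≤ 0.49)
    (h : IndepRunκ (TD τ) x₀ S (ιS S) σ β s₀) : s₀.etheta = 0 := by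
  obtain ⟨hιs, hι1, hιS⟩ := ιS_props (S : ℓ2 →L[ℂ] ℓ2)
  have hS : ‖(S : ℓ2 →L[ℂ] ℓ2)‖ ≤ 1 := norm_S_le
  have hτ2 : τ ≤ 1 / 2 := by linarith
  have hlt : τ < 1 := by linarith
  have hσ2 : σ ^ 2 ≤ σ := by nlinarith
  have hβ1 : β < 1 := by linarith
  have hν : 2 * β / σ ≤ 1 / 2 := by
    rw [div_le_iff₀ hσ]; linarith
  have hν0 : 0 ≤ 2 * β / σ := by positivity
  have hR0 : RadInv σ s₀ s₀ := by
    show |s₀.ε ^ 2 - s₀.ε ^ 2| ≤ (22 / σ + 1) * (s₀.etheta - s₀.etheta)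
    rw [sub_self, abs_zero, sub_self, mul_zero]
  have hself : ∀ s : State (TD τ) x₀ S, InvP (22 / σ) s (x₀ - s.v) s := by
    intro s
    refine ⟨le_rfl, ?_, ?_⟩
    · rw [sub_self, inner_zero_right]
    · rw [sub_self, inner_zero_right, map_zero, abs_zero, sub_self, mul_zero]
  by_contra hne
  have he0 : 0 < s₀.etheta := lt_of_le_of_ne (s₀.etheta_nonneg hx₀ hS) (Ne.symm hne)
  by_cases hdeg : cf s₀.V 0 = 0 ∨ cf s₀.V 1 = 0
  · -- degenerate start: independence fails at the first pivot
    obtain ⟨r, hr, hW⟩ := Wn_eq_smul hx₀ s₀ he0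
    have hc : cf (Wn s₀) 0 = 0 ∨ cf (Wn s₀) 1 = 0 := by
      rw [hW, cf_smul, cf_smul]
      rcases hdeg with h0 | h1
      · left; rw [h0, mul_zero]
      · right; rw [h1, mul_zero]
    have hind : IndepAtκ (ιS S) σ s₀ (x₀ - s₀.v) := h s₀ s₀ ReachN.start ReachN.start (hself s₀) he0
    have hbr : IsBracket (Wn s₀) x₀ s₀.v := isBracket_Wn hx₀ s₀ he0
    have hvz : s₀.v = bz (Wn s₀) x₀ := hbr.unique (isBracket_bz (Wn s₀) x₀)
    have hind' : IndepBrκ (Wn s₀) x₀ (x₀ - bz (Wn s₀) x₀) (ιS S) σ := by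
      have h' : IndepBrκ (Wn s₀) x₀ (x₀ - s₀.v) (ιS S) σ := hind
      rw [hvz] at h'
      exact h'
    exact not_indepBrκ_of_degenerate hτ hlt (Wn_intertwine s₀) hc x₀ hσ hind'
  · -- non-degenerate start: the potential `cyc` along the run
    have h00 : cf s₀.V 0 ≠ 0 := fun h0 => hdeg (Or.inl h0)
    have h11 : cf s₀.V 1 ≠ 0 := fun h1 => hdeg (Or.inr h1)
    set ρ : ℝ := (1 + 4 * (2 * β / σ) * τ) ^ 2 with hρ
    set K : ℝ := 22 / σ + 1 with hK
    have hK0 : 0 ≤ K := by positivity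
    have iter : ∀ n : ℕ, ∃ s : State (TD τ) x₀ S, ReachN (22 / σ) β (RadInv σ s₀) s₀ s ∧
        s.etheta = (1 - β) ^ n * s₀.etheta ∧ cf s.V 0 ≠ 0 ∧ cf s.V 1 ≠ 0 ∧ cyc s₀.V ≤ ρ ^ n * cyc s.V := by
      intro n
      induction n with
      | zero => exact ⟨s₀, ReachN.start, by rw [pow_zero, one_mul], h00, h11, by rw [pow_zero, one_mul]⟩
      | succ n ih =>
        obtain ⟨s, hs, hes, hc0, hc1, hcyc⟩ := ih
        have he : 0 < s.etheta := by rw [hes]; exact mul_pos (pow_pos (by linarith) _) he0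
        have hRs : |s.ε ^ 2 - s₀.ε ^ 2| ≤ K * (s₀.etheta - s.etheta) := hs.inv hR0
        have hβe : K * β * s.etheta ≤ K * s.etheta := by
          have h1 : β * s.etheta ≤ s.etheta := mul_le_of_le_one_left he.le hβ1.le
          have h2 := mul_le_mul_of_nonneg_left h1 hK0
          linarith [h2]
        have hab := abs_le.1 hRs
        have hlo : (0.09 : ℝ) + (22 / σ + 1) * β * s.etheta ≤ s.ε ^ 2 := by
          rw [← hK]; linarith [hab.1, hstart.1]
        have hhi : s.ε ^ 2 + (22 / σ + 1) * β * s.etheta ≤ 0.49 := by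
          rw [← hK]; linarith [hab.2, hstart.2]
        obtain ⟨s', h1, -, h3, h4, p, hp, hV'⟩ := exists_state_stepκ hιs hι1 hιS hx₀ s he hσ hσ1 hβ0.le
          hβ (x₀ - s.v) (h s s hs hs (hself s) he) hlo hhi
        have hN : ‖ιS S p‖ ≤ 2 * β / σ := (hι1 p).trans hp
        obtain ⟨r, hr, hW⟩ := Wn_eq_smul hx₀ s he
        have hV'' : s'.V = r • (s.V ∘L (1 + ιS S p)) := by rw [hV', hW, smul_comp]
        obtain ⟨hc0', hc1', hst⟩ := cyc_step hτ hτ2 (state_intertwine s) (hιS p) hN hν hc0 hc1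
        refine ⟨s', ReachN.step hs ?_ h1.le ?_, by rw [h1, hes, pow_succ]; ring, ?_, ?_, ?_⟩
        · show |s'.ε ^ 2 - s₀.ε ^ 2| ≤ (22 / σ + 1) * (s₀.etheta - s'.etheta)
          rw [← hK] at h4 ⊢
          calc |s'.ε ^ 2 - s₀.ε ^ 2| ≤ |s'.ε ^ 2 - s.ε ^ 2| + |s.ε ^ 2 - s₀.ε ^ 2| := abs_sub_le _ _ _
            _ ≤ K * β * s.etheta + K * (s₀.etheta - s.etheta) := add_le_add h4 hRs
            _ = K * (s₀.etheta - s'.etheta) := by rw [h1]; ring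
        · rw [RCLike.re_to_complex]; exact h3
        · rw [hV'', cf_smul]; exact mul_ne_zero ((map_ne_zero _).2 hr) hc0'
        · rw [hV'', cf_smul]; exact mul_ne_zero ((map_ne_zero _).2 hr) hc1'
        · rw [hV'', cyc_smul hr, pow_succ, mul_assoc]
          have hρ0 : 0 ≤ ρ ^ n := by positivity
          exact hcyc.trans (mul_le_mul_of_nonneg_left hst hρ0)
    -- the state bound along the run
    have hΔ := Δ_pos hτ hlt
    have hcyc0 : 0 < cyc s₀.V := by
      have h0 := norm_pos_iff.2 h00
      have h1 := norm_pos_iff.2 h11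
      rw [cyc]; positivity
    have hbound : ∀ n : ℕ, 0.0081 * Δ τ * cyc s₀.V ≤ ((1 - β) ^ 2 * ρ) ^ n * s₀.etheta ^ 2 := by
      intro n
      obtain ⟨s, hs, hes, hc0, hc1, hcyc⟩ := iter n
      have he : 0 < s.etheta := by rw [hes]; exact mul_pos (pow_pos (by linarith) _) he0
      have hbr : IsBracket (Wn s) x₀ s.v := isBracket_Wn hx₀ s he
      have hes' : ‖adjoint (Wn s) s.v‖ ^ 2 = s.etheta := by rw [etheta_eq_eth, eth_eq_of_isBracket hbr]
      have hb := cyc_le hτ hτ2 (Wn_intertwine s) hbr (s.window hx₀).1 (norm_x₀_sub_v_ge hx₀ s)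
      obtain ⟨r, hr, hW⟩ := Wn_eq_smul hx₀ s he
      rw [hes', hes, hW, cyc_smul hr] at hb
      have hρn : 0 < ρ ^ n := by positivity
      have h1 : 0.0081 * Δ τ * cyc s₀.V ≤ ρ ^ n * (0.0081 * Δ τ * cyc s.V) := by
        nlinarith [mul_le_mul_of_nonneg_left hcyc (by positivity : (0:ℝ) ≤ 0.0081 * Δ τ)]
      calc 0.0081 * Δ τ * cyc s₀.V ≤ ρ ^ n * (0.0081 * Δ τ * cyc s.V) := h1
        _ ≤ ρ ^ n * (((1 - β) ^ n * s₀.etheta) ^ 2) := mul_le_mul_of_nonneg_left hb hρn.le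
        _ = ((1 - β) ^ 2 * ρ) ^ n * s₀.etheta ^ 2 := by
          have e2 : ((1 - β) ^ n * s₀.etheta) ^ 2 = ((1 - β) ^ 2) ^ n * s₀.etheta ^ 2 := by
            rw [mul_pow, ← pow_mul, ← pow_mul, mul_comm n 2]
          rw [e2, mul_pow]; ring
    -- closure: `(1−β)²ρ = ((1−β)(1 + 8βτ/σ))² < 1` since `8τ/σ ≤ 0.08 < 1`
    have hq0 : 0 ≤ (1 - β) * (1 + 4 * (2 * β / σ) * τ) := by
      have : 0 ≤ 4 * (2 * β / σ) * τ := by positivity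
      nlinarith
    have hq1 : (1 - β) * (1 + 4 * (2 * β / σ) * τ) < 1 := by
      have h8 : 4 * (2 * β / σ) * τ ≤ 0.08 * β := by
        rw [show 4 * (2 * β / σ) * τ = β * (8 * τ / σ) by ring]
        have : 8 * τ / σ ≤ 0.08 := by rw [div_le_iff₀ hσ]; linarith
        nlinarith
      nlinarith
    have hr1 : (1 - β) ^ 2 * ρ < 1 := by
      have e : (1 - β) ^ 2 * ρ = ((1 - β) * (1 + 4 * (2 * β / σ) * τ)) ^ 2 := by rw [hρ]; ring
      rw [e]
      exact pow_lt_one₀ hq0 hq1 two_ne_zero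
    obtain ⟨n, hn⟩ := exists_pow_mul_lt (E := s₀.etheta ^ 2) (by positivity) hr1
      (by positivity : (0 : ℝ) < 0.0081 * Δ τ * cyc s₀.V)
    linarith [hbound n]

end run


/-! ### G. Admissible starts exist in the model (a genuine `V_y`), so `IndepRunκ` is false there -/

section start

variable {τ : ℝ}

/-- `‖T_τ‖ < 1` (`‖T_τ‖ ≤ τ`). [folklore] -/
lemma norm_TD_lt (hτ : 0 ≤ τ) (hτ1 : τ < 1) : ‖TD τ‖ < 1 :=
  (opNorm_le_bound _ hτ (norm_TD_apply_le hτ)).trans_lt hτ1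

/-- THE UNIT VECTOR `x₀ = (4/5, 3/5)`. [folklore] -/
def xD : C2 := ((4 / 5 : ℝ) : ℂ) • u 0 + ((3 / 5 : ℝ) : ℂ) • u 1

/-- `(x₀)₀ = 4/5`. [folklore] -/
@[simp] lemma xD_zero : xD 0 = ((4 / 5 : ℝ) : ℂ) := by simp [xD, u]

/-- `(x₀)₁ = 3/5`. [folklore] -/
@[simp] lemma xD_one : xD 1 = ((3 / 5 : ℝ) : ℂ) := by simp [xD, u]

/-- `‖x₀‖ = 1`. [folklore] -/
lemma norm_xD : ‖xD‖ = 1 := by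
  have h : ‖xD‖ ^ 2 = 1 := by
    rw [← norm_sq_C2, xD_zero, xD_one, Complex.norm_real, Complex.norm_real]; norm_num
  have h0 := norm_nonneg xD
  nlinarith

/-- `θ := τ²·G₁₁` (`= (εθ)₀/ε₀²` of the start below). [folklore] -/
def θ (τ : ℝ) : ℝ := τ * τ * G τ 1 1

/-- `ζ := (3/5)/(1 + θ)` (`= ε₀`, the second coordinate of the start's MC vector). [folklore] -/
def ζ (τ : ℝ) : ℝ := 3 / 5 / (1 + θ τ)

/-- `Y₀ := (4/5)/(ζτG₀₁)` (`= (4/3)(1 + θ)(1 − τ²/2)/τ`), the first coordinate of the start vector `y`, designed so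
that `(V_yV_y†z)₀ = 4/5`. [folklore] -/
def Y₀ (τ : ℝ) : ℝ := 4 / 5 / (ζ τ * τ * G τ 0 1)

/-- THE START VECTOR `y = (Y₀, τ)` (both coordinates `≠ 0`: `y` is cyclic for `T_τ`, `cyclic_yD`). [folklore] -/
def yD (τ : ℝ) : C2 := ((Y₀ τ : ℝ) : ℂ) • u 0 + ((τ : ℝ) : ℂ) • u 1

/-- `y₀ = Y₀`. [folklore] -/
@[simp] lemma yD_zero (τ : ℝ) : yD τ 0 = ((Y₀ τ : ℝ) : ℂ) := by simp [yD, u]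

/-- `y₁ = τ`. [folklore] -/
@[simp] lemma yD_one (τ : ℝ) : yD τ 1 = ((τ : ℝ) : ℂ) := by simp [yD, u]

/-- THE START'S MC VECTOR `z = (0, ζ)`. [folklore] -/
def zD (τ : ℝ) : C2 := ((ζ τ : ℝ) : ℂ) • u 1

/-- `z₀ = 0`. [folklore] -/
@[simp] lemma zD_zero (τ : ℝ) : zD τ 0 = 0 := by simp [zD, u]

/-- `z₁ = ζ`. [folklore] -/
@[simp] lemma zD_one (τ : ℝ) : zD τ 1 = ((ζ τ : ℝ) : ℂ) := by simp [zD, u]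

/-- THE START OPERATOR IS THE PAPER'S `V_y` for `T_τ` and `y = (Y₀, τ)`. [cite: Enflo2023, v2 (2) p.2] -/
def WD (τ : ℝ) (hτ : 0 < τ) (hτ1 : τ < 1) : ℓ2 →L[ℂ] C2 := Vy.V (TD τ) (norm_TD_lt hτ.le hτ1) (yD τ)

/-- `V_y` intertwines ((9)/(31)). [cite: Enflo2023, v2 (9) p.4] -/
lemma WD_intertwine (hτ : 0 < τ) (hτ1 : τ < 1) (b : ℓ2) : WD τ hτ hτ1 (S b) = TD τ (WD τ hτ hτ1 b) :=
  V_shift _ _ _ b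

/-- the coefficients of `V_y` are `c_i = conj yᵢ` ((3)–(4)). [cite: Enflo2023, v2 (3)–(4) p.2] -/
lemma cf_WD (hτ : 0 < τ) (hτ1 : τ < 1) (i : Fin 2) : cf (WD τ hτ hτ1) i = conj (yD τ i) := by
  rw [cf, WD, u, adjoint_V_coord, pow_zero, one_apply_eq_self, EuclideanSpace.inner_single_right, one_mul]

/-- `c₀ = Y₀`. [cite: Enflo2023, v2 (3)–(4) p.2] -/
lemma cf_WD_zero (hτ : 0 < τ) (hτ1 : τ < 1) : cf (WD τ hτ hτ1) 0 = ((Y₀ τ : ℝ) : ℂ) := by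
  rw [cf_WD, yD_zero, Complex.conj_ofReal]

/-- `c₁ = τ`. [cite: Enflo2023, v2 (3)–(4) p.2] -/
lemma cf_WD_one (hτ : 0 < τ) (hτ1 : τ < 1) : cf (WD τ hτ hτ1) 1 = ((τ : ℝ) : ℂ) := by
  rw [cf_WD, yD_one, Complex.conj_ofReal]

/-- numerical facts about `θ` for `0 < τ ≤ 1/100`. [folklore] -/
lemma θ_bounds (hτ : 0 < τ) (hτ1 : τ ≤ 1 / 100) : 0 < θ τ ∧ θ τ ≤ 2 * (τ * τ) ∧ θ τ ≤ 1 / 5000 := by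
  obtain ⟨h11, h10, h02, -⟩ := G_bounds hτ (by linarith)
  have hττ : 0 < τ * τ := mul_pos hτ hτ
  have h2 : θ τ ≤ 2 * (τ * τ) := by
    rw [θ]; nlinarith
  refine ⟨by rw [θ]; positivity, h2, ?_⟩
  nlinarith

/-- `0 < ζ` and `0 < Y₀`. [folklore] -/
lemma ζ_pos_Y₀_pos (hτ : 0 < τ) (hτ1 : τ ≤ 1 / 100) : 0 < ζ τ ∧ 0 < Y₀ τ := by
  obtain ⟨hθ, -, -⟩ := θ_bounds hτ hτ1
  obtain ⟨-, -, -, hG⟩ := G_bounds hτ (by linarith)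
  have hζ : 0 < ζ τ := by rw [ζ]; positivity
  exact ⟨hζ, by rw [Y₀]; exact div_pos (by norm_num) (mul_pos (mul_pos hζ hτ) hG)⟩

/-- **THE START IS A BRACKET POINT**: `z + V_yV_y†z = x₀`. [cite: Enflo2023, v2 (15) p.6] -/
lemma isBracket_start (hτ : 0 < τ) (hτ1 : τ ≤ 1 / 100) :
    IsBracket (WD τ hτ (by linarith)) xD (zD τ) := by
  have hlt : τ < 1 := by linarith
  obtain ⟨hθ, -, -⟩ := θ_bounds hτ hτ1
  have hK := K_apply hτ hlt (WD_intertwine hτ hlt) (zD τ)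
  obtain ⟨hζ, hY⟩ := ζ_pos_Y₀_pos hτ hτ1
  obtain ⟨-, -, -, hG⟩ := G_bounds hτ (by linarith)
  -- the two real identities behind the design of `y`
  have r0 : Y₀ τ * (ζ τ * τ * G τ 0 1) = 4 / 5 := by
    rw [Y₀]; exact div_mul_cancel₀ _ (mul_pos (mul_pos hζ hτ) hG).ne'
  have r1 : ζ τ + τ * (ζ τ * τ * G τ 1 1) = 3 / 5 := by
    have e : ζ τ + τ * (ζ τ * τ * G τ 1 1) = ζ τ * (1 + θ τ) := by rw [θ]; ring
    rw [e, ζ, div_mul_cancel₀ _ (by linarith)]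
  show zD τ + WD τ hτ hlt (adjoint (WD τ hτ hlt) (zD τ)) = xD
  ext i
  fin_cases i
  · show zD τ 0 + WD τ hτ hlt (adjoint (WD τ hτ hlt) (zD τ)) 0 = xD 0
    rw [hK, zD_zero, zD_one, xD_zero, cf_WD_zero, cf_WD_one, Complex.conj_ofReal, zero_mul, zero_mul,
      zero_add, zero_add, ← Complex.ofReal_mul, ← Complex.ofReal_mul, ← Complex.ofReal_mul, r0]
  · show zD τ 1 + WD τ hτ hlt (adjoint (WD τ hτ hlt) (zD τ)) 1 = xD 1
    rw [hK, zD_zero, zD_one, xD_one, cf_WD_zero, cf_WD_one, Complex.conj_ofReal, zero_mul, zero_mul, zero_add,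
      ← Complex.ofReal_mul, ← Complex.ofReal_mul, ← Complex.ofReal_mul, ← Complex.ofReal_add, r1]

/-- `(εθ)₀ = ‖V_y†z‖² = ζ²θ`. [cite: Enflo2023, v2 (16) p.6] -/
lemma norm_adjoint_start_sq (hτ : 0 < τ) (hτ1 : τ < 1) :
    ‖adjoint (WD τ hτ hτ1) (zD τ)‖ ^ 2 = ζ τ ^ 2 * θ τ := by
  rw [adjoint_eq hτ hτ1 (WD_intertwine hτ hτ1), zD_zero, zero_mul, zero_smul, zero_add, norm_smul, mul_pow,
    norm_gv_sq (abs_wt_lt hτ hτ1 1), zD_one, cf_WD_one, ← Complex.ofReal_mul, Complex.norm_real, Real.norm_eq_abs,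
    sq_abs, θ, G, wt_one]
  ring

/-- **AN ADMISSIBLE START EXISTS AT `x₀ = (4/5, 3/5)`**: for `0 < τ ≤ σ/100`, `0 < σ ≤ 1` the TRUE MC state of
`V_y`, `y = (Y₀, τ)` (bracket point `z = (0, ζ)`, `ε = ζ ∈ [0.3, 0.7]`, `ℓ = V_y†z` the minimiser) has
`0 < (εθ)₀ ≤ τ²` and satisfies the run's start margin `0.09 + (22/σ + 1)(εθ)₀ ≤ ε₀² ≤ 0.49 − (22/σ + 1)(εθ)₀`.
[cite: Enflo2023, v2 (2) p.2, (15) p.6, p.17 (window of ε)] -/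
theorem exists_start_at {σ : ℝ} (hτ : 0 < τ) (hσ : 0 < σ) (hσ1 : σ ≤ 1) (hτσ : τ ≤ σ / 100) :
    ∃ s₀ : State (TD τ) xD S, s₀.V = WD τ hτ (by linarith) ∧ 0 < s₀.etheta ∧ s₀.etheta ≤ τ ^ 2 ∧
      ((0.09 : ℝ) + (22 / σ + 1) * s₀.etheta ≤ s₀.ε ^ 2 ∧ s₀.ε ^ 2 + (22 / σ + 1) * s₀.etheta ≤ 0.49) := by
  have hτ1 : τ ≤ 1 / 100 := by linarith
  have hlt : τ < 1 := by linarith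
  obtain ⟨hθ0, hθ2, hθ5⟩ := θ_bounds hτ hτ1
  have hbr := isBracket_start hτ hτ1
  -- `ε = ζ ∈ [0.59, 0.6]`
  have hζlo : 0.59 ≤ ζ τ := by rw [ζ, le_div_iff₀ (by linarith)]; nlinarith
  have hζhi : ζ τ ≤ 0.6 := by rw [ζ, div_le_iff₀ (by linarith)]; nlinarith
  have hnz : ‖zD τ‖ = ζ τ := by
    rw [zD, norm_smul, Complex.norm_real, Real.norm_of_nonneg (by linarith), u, PiLp.norm_single,
      norm_one, mul_one]
  have hwin : (0.3 : ℝ) ≤ ‖zD τ‖ ∧ ‖zD τ‖ ≤ 0.7 := by rw [hnz]; constructor <;> linarith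
  have heth := norm_adjoint_start_sq hτ hlt
  -- the state
  let s₀ : State (TD τ) xD S := ⟨WD τ hτ hlt, WD_intertwine hτ hlt, ‖zD τ‖, hwin, _, hbr.isMinimal⟩
  have hv : s₀.v = zD τ := hbr.sub_eq
  have he : s₀.etheta = ζ τ ^ 2 * θ τ := by rw [etheta_eq_eth, hv, eth_eq_of_isBracket hbr, heth]
  have hε : s₀.ε = ζ τ := hnz
  have hζ2 : ζ τ ^ 2 ≤ 0.36 := by nlinarith
  have hζ2' : 0.348 ≤ ζ τ ^ 2 := by nlinarith
  have heτ : ζ τ ^ 2 * θ τ ≤ τ ^ 2 := by rw [pow_two τ]; nlinarith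
  have hm : (22 / σ + 1) * (ζ τ ^ 2 * θ τ) ≤ 0.01 := by
    have h1 : (22 / σ + 1) * (ζ τ ^ 2 * θ τ) ≤ (22 / σ + 1) * (2 * (τ * τ)) :=
      mul_le_mul_of_nonneg_left (by nlinarith) (by positivity)
    have h2 : 22 / σ * τ ≤ 22 / 100 := by
      rw [div_mul_eq_mul_div, div_le_iff₀ hσ]; linarith
    have e : (22 / σ + 1) * (2 * (τ * τ)) = 2 * τ * (22 / σ * τ) + 2 * (τ * τ) := by ring
    rw [e] at h1
    nlinarith
  refine ⟨s₀, rfl, by rw [he]; positivity, by rw [he]; exact heτ, ?_, ?_⟩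
  · rw [hε, he]; linarith
  · rw [hε, he]; linarith

/-- **`IndepRunκ` IS FALSE IN THE TYPE-1 MODEL**: for `0 < τ ≤ σ/100`, `0 < σ ≤ 1`, `0 < β ≤ σ²/1000` there is an
admissible start (unit `x₀`, true MC state `s₀` of a `V_y` over the shift `S` on `ℓ²`, with the start margin and
`(εθ)₀ > 0`) at which the run-level intrinsic independence hypothesis fails. [cite: Enflo2023, v2 (34) p.16; p.19–20] -/
theorem not_indepRunκ {σ β : ℝ} (hτ : 0 < τ) (hσ : 0 < σ) (hσ1 : σ ≤ 1) (hτσ : τ ≤ σ / 100)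
    (hβ0 : 0 < β) (hβ : β ≤ σ ^ 2 / 1000) :
    ∃ (x₀ : C2) (s₀ : State (TD τ) x₀ S), ‖x₀‖ = 1 ∧ 0 < s₀.etheta ∧
      ((0.09 : ℝ) + (22 / σ + 1) * s₀.etheta ≤ s₀.ε ^ 2 ∧ s₀.ε ^ 2 + (22 / σ + 1) * s₀.etheta ≤ 0.49) ∧
      ¬ IndepRunκ (TD τ) x₀ S (ιS S) σ β s₀ := by
  obtain ⟨s₀, -, he, -, hstart⟩ := exists_start_at hτ hσ hσ1 hτσ
  exact ⟨xD, s₀, norm_xD, he, hstart,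
    fun h => he.ne' (indepRunκ_etheta_eq_zero hτ norm_xD hσ hσ1 hτσ hβ0 hβ s₀ hstart h)⟩

end start

/-! ### H. The model operator itself: TYPE 1, not type 2, injective, with cyclic vectors — and with invariant
subspaces (finite dimension), so nothing here contradicts an assertion of the text about operators without them -/

section facts

variable {τ : ℝ}

/-- iterates of `T_τ` in coordinates. [folklore] -/
lemma TD_iterate_apply (τ : ℝ) (j : ℕ) (y : C2) (i : Fin 2) :
    ((⇑(TD τ))^[j] y) i = ((wt τ i : ℝ) : ℂ) ^ j * y i := by
  induction j with
  | zero => rw [Function.iterate_zero, id, pow_zero, one_mul]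
  | succ j ih => rw [Function.iterate_succ_apply', TD_apply, ih, pow_succ]; ring

/-- `⟨T_τʲy, y⟩ = τʲ|y₀|² + (τ/2)ʲ|y₁|²` (real, `≥ (τ/2)ʲ‖y‖²`). [cite: Enflo2023, v2 p.6 (type 1)] -/
lemma inner_TD_iterate (τ : ℝ) (j : ℕ) (y : C2) :
    ⟪(⇑(TD τ))^[j] y, y⟫_ℂ = ((wt τ 0 ^ j * ‖y 0‖ ^ 2 + wt τ 1 ^ j * ‖y 1‖ ^ 2 : ℝ) : ℂ) := by
  rw [PiLp.inner_apply, Fin.sum_univ_two, TD_iterate_apply, TD_iterate_apply]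
  simp only [RCLike.inner_apply', map_mul, map_pow, Complex.conj_ofReal]
  have hz : ∀ z : ℂ, conj z * z = ((‖z‖ ^ 2 : ℝ) : ℂ) := fun z => by
    rw [mul_comm, Complex.mul_conj, Complex.normSq_eq_norm_sq]
  rw [mul_assoc, hz, mul_assoc, hz]
  push_cast
  ring

/-- `‖u_i‖ = 1`. [folklore] -/
lemma norm_u (i : Fin 2) : ‖u i‖ = 1 := by rw [u, PiLp.norm_single, norm_one]

/-- **THE MODEL OPERATOR IS OF TYPE 1** (v2 p.6), in the strongest form: with `u₀ = e₀` (any unit vector works),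
`δ_n = (τ/2)ⁿ` and `j = n`, the inequality `|⟨Tʲy, y⟩| ≥ δ_n‖y‖²` holds for EVERY `y` (no angular condition
needed): `⟨T_τʲy, y⟩ = τʲ|y₀|² + (τ/2)ʲ|y₁|²`. [cite: Enflo2023, v2 p.6 (definition of type 1)] -/
theorem type1 (hτ : 0 < τ) : Referee.Type1 (TD τ) := by
  refine ⟨u 0, norm_u 0, fun n _ => ⟨(τ / 2) ^ n, by positivity, fun y _ => ⟨n, le_rfl, ?_⟩⟩⟩
  have hnn : 0 ≤ wt τ 0 ^ n * ‖y 0‖ ^ 2 + wt τ 1 ^ n * ‖y 1‖ ^ 2 := by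
    rw [wt_zero, wt_one]; positivity
  rw [inner_TD_iterate, Complex.norm_real, Real.norm_of_nonneg hnn, ← norm_sq_C2, wt_zero, wt_one]
  have h1 : (τ / 2) ^ n ≤ τ ^ n := pow_le_pow_left₀ (by positivity) (by linarith) n
  nlinarith [norm_nonneg (y 0), sq_nonneg ‖y 0‖, mul_le_mul_of_nonneg_right h1 (sq_nonneg ‖y 0‖)]

/-- … hence NOT of type 2 (the classes are disjoint). [cite: Enflo2023, v2 p.7] -/
theorem not_type2 (hτ : 0 < τ) : ¬ Referee.Type2 (TD τ) := fun h2 =>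
  Referee.not_type1_and_type2 (TD τ) ⟨type1 hτ, h2⟩

/-- `T_τ` is injective (for `τ ≠ 0`). [folklore] -/
theorem TD_injective (hτ : 0 < τ) : Function.Injective (TD τ) := by
  intro v w h
  ext i
  have hi := congrArg (fun x : C2 => x i) h
  simp only [TD_apply] at hi
  have hw : ((wt τ i : ℝ) : ℂ) ≠ 0 := by
    fin_cases i
    · exact_mod_cast hτ.ne'
    · show ((τ / 2 : ℝ) : ℂ) ≠ 0
      exact_mod_cast (by positivity : (0 : ℝ) < τ / 2).ne'
  exact mul_left_cancel₀ hw hi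

/-- `T_τ u₁ = (τ/2)u₁`. [folklore] -/
lemma TD_u_one (τ : ℝ) : TD τ (u 1) = ((τ / 2 : ℝ) : ℂ) • u 1 := by
  ext i
  fin_cases i <;> simp [TD_apply, u]

/-- **THE MODEL OPERATOR HAS A NON-TRIVIAL CLOSED INVARIANT SUBSPACE** (the eigenline `ℂu₁`; the orbit of `u₁` is
orthogonal to `u₀`) — as every operator on `ℂ²` does. [folklore] -/
theorem hasNontrivialClosedInvariantSubspace (τ : ℝ) : HasNontrivialClosedInvariantSubspace (TD τ) := by
  have h1 : u 1 ≠ (0 : C2) := fun h => by simpa [h] using norm_u 1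
  have h0 : u 0 ≠ (0 : C2) := fun h => by simpa [h] using norm_u 0
  refine hasNontrivialClosedInvariantSubspace_of_orbit_orthogonal (TD τ) h1 h0 fun j => ?_
  induction j with
  | zero => rw [pow_zero, one_apply_eq_self, inner_u_right, u_one_zero, map_zero]
  | succ k ih =>
    rw [pow_succ]
    show ⟪(TD τ ^ k) (TD τ (u 1)), u 0⟫_ℂ = 0
    rw [TD_u_one, map_smul, inner_smul_left, ih, mul_zero]

/-- **CYCLIC VECTORS**: every `y` with `y₀y₁ ≠ 0` is cyclic for `T_τ` (`span{y, T_τy} = ℂ²` as the eigenvalues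
`τ ≠ τ/2`); in particular `x₀ = (4/5, 3/5)` and the start vector `y = (Y₀, τ)` are cyclic — the model is not
defeated by a trivially non-cyclic vector. [cite: Enflo2023, v2 p.3 ("then `y₀` is non-cyclic")] -/
theorem cyclic_of_ne (hτ : 0 < τ) {y : C2} (h0 : y 0 ≠ 0) (h1 : y 1 ≠ 0) : ¬ IsNonCyclic (TD τ) y := by
  intro hnc
  apply hnc
  rw [orbitClosure, eq_top_iff]
  set M : Submodule ℂ C2 := Submodule.span ℂ (Set.range fun j : ℕ => (TD τ ^ j) y) with hM
  have hy : y ∈ M := Submodule.subset_span ⟨0, by dsimp only; rw [pow_zero, one_apply_eq_self]⟩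
  have hTy : TD τ y ∈ M := Submodule.subset_span ⟨1, by dsimp only; rw [pow_one]⟩
  -- `T y − (τ/2) y = (τ/2) y₀ u₀` and `τ y − T y = (τ/2) y₁ u₁`
  have hd0 : TD τ y - ((τ / 2 : ℝ) : ℂ) • y = (((τ / 2 : ℝ) : ℂ) * y 0) • u 0 := by
    ext i
    fin_cases i
    · simp [TD_apply, u]; ring
    · simp [TD_apply, u]
  have hd1 : ((τ : ℝ) : ℂ) • y - TD τ y = (((τ / 2 : ℝ) : ℂ) * y 1) • u 1 := by
    ext i
    fin_cases i
    · simp [TD_apply, u]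
    · simp [TD_apply, u]; ring
  have hc0 : ((τ / 2 : ℝ) : ℂ) * y 0 ≠ 0 := mul_ne_zero (by exact_mod_cast (by positivity : (0:ℝ) < τ / 2).ne') h0
  have hc1 : ((τ / 2 : ℝ) : ℂ) * y 1 ≠ 0 := mul_ne_zero (by exact_mod_cast (by positivity : (0:ℝ) < τ / 2).ne') h1
  have hu0 : u 0 ∈ M := by
    have hm : (((τ / 2 : ℝ) : ℂ) * y 0) • u 0 ∈ M := by rw [← hd0]; exact M.sub_mem hTy (M.smul_mem _ hy)
    have := M.smul_mem ((((τ / 2 : ℝ) : ℂ) * y 0))⁻¹ hm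
    rwa [smul_smul, inv_mul_cancel₀ hc0, one_smul] at this
  have hu1 : u 1 ∈ M := by
    have hm : (((τ / 2 : ℝ) : ℂ) * y 1) • u 1 ∈ M := by rw [← hd1]; exact M.sub_mem (M.smul_mem _ hy) hTy
    have := M.smul_mem ((((τ / 2 : ℝ) : ℂ) * y 1))⁻¹ hm
    rwa [smul_smul, inv_mul_cancel₀ hc1, one_smul] at this
  intro v _
  apply M.le_topologicalClosure
  rw [decomp_u v]
  exact M.add_mem (M.smul_mem _ hu0) (M.smul_mem _ hu1)

/-- `x₀ = (4/5, 3/5)` is cyclic for `T_τ`. [folklore] -/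
theorem cyclic_xD (hτ : 0 < τ) : ¬ IsNonCyclic (TD τ) xD :=
  cyclic_of_ne hτ (by rw [xD_zero]; norm_num) (by rw [xD_one]; norm_num)

/-- the start vector `y = (Y₀, τ)` is cyclic for `T_τ` (`0 < τ ≤ 1/100`). [folklore] -/
theorem cyclic_yD (hτ : 0 < τ) (hτ1 : τ ≤ 1 / 100) : ¬ IsNonCyclic (TD τ) (yD τ) := by
  obtain ⟨-, hY⟩ := ζ_pos_Y₀_pos hτ hτ1
  exact cyclic_of_ne hτ (by rw [yD_zero]; exact Complex.ofReal_ne_zero.2 hY.ne')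
    (by rw [yD_one]; exact Complex.ofReal_ne_zero.2 hτ.ne')

end facts

end Diag
end StepRealisation
end Literature.Analysis.OperatorTheory.Enflo2023
end
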